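import Mathlib
import Summits.ValiantsHypothesis.ValiantsHypothesis.Theorems.NewtonUnitEquationsTwoProductsPlanarCrossCount
import Summits.ValiantsHypothesis.ValiantsHypothesis.Theorems.NewtonUnitEquationsTwoProductsFormalLogLinearisationLiftedPencilCountBound
import Summits.ValiantsHypothesis.ValiantsHypothesis.Theorems.NewtonUnitEquationsTwoProductsPlanarCellBlockMerge
import HarnessLib

/-!
# Route NewtonUnitEquations — crux `TwoProducts` (stmt-ValiantsHypothesis-5906): the PERMUTATION-TYPE LAW
# (rung R3 of the registered line `Cruxes/TwoProducts/Lines/relation_ladder.lean`, val-idea-8 g2; verbatim its `Lifted` toolkit @47fa98797544)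

Helper mode (`--supports stmt-ValiantsHypothesis-5906 --as helper`; turnkey packaged by the ideator seat val-idea-8 g2).
Setting of `…FormalLogLinearisationDefs` / `…PlanarCrossCount`: constant-free tails `u, v : Fin m → ℂ[x,y]`, tail alphabet
`T = tailSupport u v`, valid weights `ξ` (`wt ξ e < 0` on `T`), visible points = strict `ξ`-tops of `supp (tailDiff u v)`.
**`visibleCount_of_isBm`**: if `T` is a `B_m`-SET (`IsBm m T`: multisets of `≤ m` letters are determined by their sums — every
additive coincidence between letter tuples is of PERMUTATION TYPE), then GLOBALLY `#visible ≤ 2^{13m}(#T+2)^2`.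
Proof (all here): (A) the Wronskian-congruence log-linearisation chain of `…TwoProductsPowerSumCriterion`, re-proved over an
ARBITRARY finite variable type with REAL additive weights `ω ≥ 1` on nonzero exponents (`strictMin_sub_iff_of_congr`), with the
real Euler derivation (`coeff_eulerDerivation`); (C) for linear forms `U_j = Σ_e c_{je} Y_e` the truncated `Σ log(1+U_j) − Σ log(1+V_j)`
has coefficient `(−1)^{k+1}/k · multinomial(κ) · (Σ_j c_j^κ − Σ_j d_j^κ)` at `κ` (`coeff_logTrunc`), so a strict `θ`-minimum of the
lifted support of `∏(1+U_j) − ∏(1+V_j)` is the strict `θ`-minimal UNEQUAL MOMENT (`lifted_minUnequal`); (D) the push-forward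
`Y_e ↦ X^e` maps the lifted difference to `tailDiff u v` (`phi_liftG`) and is injective on exponents of degree `≤ m` under `IsBm`
(`injDeg_of_isBm`), so a planar visible point lifts to a strict extremum (`minUnequal_of_visible`); (E) weights normalised by
`wt ζ e₀ = −1` form one affine pencil (`pencil_param`); (F) the landed `liftedPencilCount_bound` / `liftedPencilCount_arith`.
(G) FAMILY-LEVEL version `visibleCount_of_permType` (rung R3♯): the same bound under the position-aware hypothesis that every
coincidence of the letter family is of permutation type (`PermType`), via `injOn_of_permType` (a lifted support point of
`∏(1+U_j)` is the letter multiset of a tuple of the family) and `count_of_injOn`; it contains p603804's dissociated regime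
(`permType_of_injOn`) as a GLOBAL bound.
(R5) MERGED version `visibleCount_of_mergedPermType`: contract a block `J ∋ j₀` with sumset `≤ M` (`merge`/`mergeA`, landed
`…PlanarCellBlockMerge`); permutation type of the merged family suffices — contains (G) and the confined-block regime of
`planarCell_blockLaw` (`visibleCount_of_confined_blockSmall`).
Honest framing: a rung of a crux line (the permutation-type case of the lifted → planar step); the line's residual
(`ResidualLawV6`: genuine multiset relations with large blocks), `PlanarCellBound`, the crux `TwoProducts` and `VP ≠ VNP` are
OPEN and NOT claimed.  No instances, no notation, no named literature facts. [folklore]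
-/

noncomputable section

-- Sub = Summit single-conjunct layout: the duplicated namespace component is mandated by the tree.
set_option linter.dupNamespace false

namespace Summit.ValiantsHypothesis.ValiantsHypothesis.Theorems.NewtonUnitEquations.TwoProducts.PermutationType
open scoped BigOperators
open MvPolynomial

variable {σ : Type*} [Fintype σ] [DecidableEq σ]

omit [Fintype σ] [DecidableEq σ] in
/-- An additive weight vanishes at the zero exponent. [folklore] -/
theorem wt_zero (ω : (σ →₀ ℕ) → ℝ) (hadd : ∀ p q, ω (p + q) = ω p + ω q) : ω 0 = 0 := by
  linarith [hadd 0 0, congrArg ω (add_zero (0 : σ →₀ ℕ))]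

omit [Fintype σ] in
/-- An additive weight that is `≥ 1` on nonzero exponents is nonnegative. [folklore] -/
theorem wt_nonneg (ω : (σ →₀ ℕ) → ℝ) (hadd : ∀ p q, ω (p + q) = ω p + ω q)
    (hpos : ∀ p, p ≠ 0 → 1 ≤ ω p) (p : σ →₀ ℕ) : 0 ≤ ω p := by
  by_cases hp : p = 0
  · rw [hp, wt_zero ω hadd]
  · linarith [hpos p hp]

omit [Fintype σ] in
/-- Congruence of coefficients below a weight bound is preserved by products. [folklore] -/
theorem coeff_mul_congr_below (ω : (σ →₀ ℕ) → ℝ) (hadd : ∀ p q, ω (p + q) = ω p + ω q)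
    (hpos : ∀ p, p ≠ 0 → 1 ≤ ω p) (N : ℝ) (A A' B B' : MvPolynomial σ ℂ)
    (hA : ∀ p, ω p < N → coeff p A = coeff p A') (hB : ∀ p, ω p < N → coeff p B = coeff p B') :
    ∀ p, ω p < N → coeff p (A * B) = coeff p (A' * B') := by
  intro p hp
  rw [coeff_mul, coeff_mul]
  refine Finset.sum_congr rfl fun x hx => ?_
  rw [Finset.HasAntidiagonal.mem_antidiagonal] at hx
  have h1 := wt_nonneg ω hadd hpos x.1
  have h2 := wt_nonneg ω hadd hpos x.2
  rw [← hx, hadd] at hp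
  rw [hA x.1 (by linarith), hB x.2 (by linarith)]

omit [Fintype σ] in
/-- Support points of `h ^ s`, `h` constant-free, weigh at least `s`. [folklore] -/
theorem le_wt_of_mem_support_pow (ω : (σ →₀ ℕ) → ℝ) (hadd : ∀ p q, ω (p + q) = ω p + ω q)
    (hpos : ∀ p, p ≠ 0 → 1 ≤ ω p) (h : MvPolynomial σ ℂ) (h0 : coeff 0 h = 0) :
    ∀ (s : ℕ) (p : σ →₀ ℕ), p ∈ (h ^ s).support → (s : ℝ) ≤ ω p := by
  intro s
  induction s with
  | zero =>
    intro p hp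
    rw [pow_zero, mem_support_iff, coeff_one] at hp
    split_ifs at hp with h'
    · simp [← h', wt_zero ω hadd]
    · exact absurd rfl hp
  | succ s ih =>
    intro p hp
    obtain ⟨a, ha, b, hb, rfl⟩ := Finset.mem_add.mp (support_mul _ _ (pow_succ h s ▸ hp))
    have hb0 : b ≠ 0 := by rintro rfl; exact (mem_support_iff.mp hb) h0
    rw [hadd]
    push_cast
    linarith [ih a ha, hpos b hb0]

omit [Fintype σ] in
/-- `h ^ R`, `h` constant-free, has no coefficients of weight `< R`. [folklore] -/
theorem coeff_pow_eq_zero_below (ω : (σ →₀ ℕ) → ℝ) (hadd : ∀ p q, ω (p + q) = ω p + ω q)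
    (hpos : ∀ p, p ≠ 0 → 1 ≤ ω p) (h : MvPolynomial σ ℂ) (h0 : coeff 0 h = 0) (R : ℕ)
    (p : σ →₀ ℕ) (hp : ω p < (R : ℝ)) : coeff p (h ^ R) = 0 := by
  by_contra hne
  exact absurd (le_wt_of_mem_support_pow ω hadd hpos h h0 R p (mem_support_iff.mpr hne))
    (not_le.mpr hp)

omit [Fintype σ] in
/-- A support point of `A * B` is a support point of `A` or strictly heavier than one. [folklore] -/
theorem exists_support_left_of_mem_support_mul (ω : (σ →₀ ℕ) → ℝ)
    (hadd : ∀ p q, ω (p + q) = ω p + ω q) (hpos : ∀ p, p ≠ 0 → 1 ≤ ω p)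
    (A B : MvPolynomial σ ℂ) (p : σ →₀ ℕ) (hp : p ∈ (A * B).support) :
    ∃ q ∈ A.support, ω q < ω p ∨ q = p := by
  obtain ⟨a, ha, b, hb, rfl⟩ := Finset.mem_add.mp (support_mul _ _ hp)
  refine ⟨a, ha, ?_⟩
  by_cases hb0 : b = 0
  · exact Or.inr (by rw [hb0, add_zero])
  · exact Or.inl (by rw [hadd]; linarith [hpos b hb0])

omit [Fintype σ] in
/-- At an exponent not heavier than any support point of `A`, the coefficient of `A * B` is
`coeff p A * coeff 0 B`. [folklore] -/
theorem coeff_mul_of_isMin (ω : (σ →₀ ℕ) → ℝ) (hadd : ∀ p q, ω (p + q) = ω p + ω q)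
    (hpos : ∀ p, p ≠ 0 → 1 ≤ ω p) (A B : MvPolynomial σ ℂ) (p : σ →₀ ℕ)
    (hmin : ∀ q ∈ A.support, ω p ≤ ω q) : coeff p (A * B) = coeff p A * coeff 0 B := by
  rw [coeff_mul, Finset.sum_eq_single_of_mem (p, 0) (by simp)]
  rintro ⟨a, b⟩ hx hne
  have hx' : a + b = p := Finset.HasAntidiagonal.mem_antidiagonal.mp hx
  have hb0 : b ≠ 0 := by rintro rfl; rw [add_zero] at hx'; exact hne (by rw [hx'])
  have ha : coeff a A = 0 := by
    by_contra hne'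
    have := hmin a (mem_support_iff.mpr hne')
    rw [← hx', hadd] at this
    linarith [hpos b hb0]
  rw [ha, zero_mul]

omit [Fintype σ] [DecidableEq σ] in
/-- The support of an Euler-type image `T` of `A` lies in the support of `A`. [folklore] -/
theorem mem_support_of_mem_support_euler (ω : (σ →₀ ℕ) → ℝ) (A T : MvPolynomial σ ℂ)
    (hT : ∀ q, coeff q T = (ω q : ℂ) * coeff q A) {q : σ →₀ ℕ} (hq : q ∈ T.support) :
    q ∈ A.support := by
  rw [mem_support_iff] at hq ⊢
  exact right_ne_zero_of_mul (hT q ▸ hq)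

omit [Fintype σ] [DecidableEq σ] in
/-- Abstract transfer of "`e` is the unique lightest support point" from `A` to `C`: every support
point of `C` is a support point of `A` or strictly heavier than one, and every lightest support
point of `A` is a support point of `C`. [folklore] -/
theorem strictMin_transfer (ω : (σ →₀ ℕ) → ℝ) (A C : MvPolynomial σ ℂ)
    (h1 : ∀ p ∈ C.support, ∃ q ∈ A.support, ω q < ω p ∨ q = p)
    (h2 : ∀ p ∈ A.support, (∀ q ∈ A.support, ω p ≤ ω q) → p ∈ C.support) (e : σ →₀ ℕ) :
    (e ∈ C.support ∧ ∀ e' ∈ C.support, e' ≠ e → ω e < ω e') ↔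
      (e ∈ A.support ∧ ∀ e' ∈ A.support, e' ≠ e → ω e < ω e') := by
  constructor
  · rintro ⟨he, hmin⟩
    obtain ⟨q₀, hq₀, -⟩ := h1 e he
    obtain ⟨p₀, hp₀, hp₀min⟩ := Finset.exists_min_image A.support ω ⟨q₀, hq₀⟩
    have hp₀C : p₀ ∈ C.support := h2 p₀ hp₀ hp₀min
    have he0 : e = p₀ := by
      by_contra hne
      have hlt : ω e < ω p₀ := hmin p₀ hp₀C (Ne.symm hne)
      obtain ⟨q, hq, hq'⟩ := h1 e he
      rcases hq' with hlt' | rfl <;> linarith [hp₀min _ hq]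
    subst he0
    refine ⟨hp₀, fun e' he' hne => ?_⟩
    exact (hp₀min e' he').lt_or_eq.elim id fun heq =>
      hmin e' (h2 e' he' fun q hq => heq ▸ hp₀min q hq) hne
  · rintro ⟨he, hmin⟩
    have heC : e ∈ C.support :=
      h2 e he fun q hq => (eq_or_ne q e).elim (fun h => h ▸ le_rfl) fun h => (hmin q hq h).le
    refine ⟨heC, fun e' he' hne => ?_⟩
    obtain ⟨q, hq, hq'⟩ := h1 e' he'
    rcases hq' with hlt | rfl
    · exact (eq_or_ne q e).elim (fun hqe => hqe ▸ hlt) fun hqe => lt_trans (hmin q hq hqe) hlt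
    · exact hmin _ hq hne

omit [Fintype σ] in
/-- For `A` constant-free with Euler-type image `T`, and `B` with constant term `1`: `e` is the
unique lightest support point of `T * B` iff it is for `A`. [folklore] -/
theorem strictMin_euler_mul_iff (ω : (σ →₀ ℕ) → ℝ) (hadd : ∀ p q, ω (p + q) = ω p + ω q)
    (hpos : ∀ p, p ≠ 0 → 1 ≤ ω p) (A T B : MvPolynomial σ ℂ)
    (hT : ∀ q, coeff q T = (ω q : ℂ) * coeff q A) (hA : coeff 0 A = 0) (hB : coeff 0 B = 1)
    (e : σ →₀ ℕ) :
    (e ∈ (T * B).support ∧ ∀ e' ∈ (T * B).support, e' ≠ e → ω e < ω e') ↔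
      (e ∈ A.support ∧ ∀ e' ∈ A.support, e' ≠ e → ω e < ω e') := by
  refine strictMin_transfer ω A (T * B) (fun p hp => ?_) (fun p hp hmin => ?_) e
  · obtain ⟨q, hq, hq'⟩ := exists_support_left_of_mem_support_mul ω hadd hpos T B p hp
    exact ⟨q, mem_support_of_mem_support_euler ω A T hT hq, hq'⟩
  · have hp0 : p ≠ 0 := by rintro rfl; exact (mem_support_iff.mp hp) hA
    rw [mem_support_iff, coeff_mul_of_isMin ω hadd hpos T B p
      (fun q hq => hmin q (mem_support_of_mem_support_euler ω A T hT hq)), hB, mul_one, hT]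
    exact mul_ne_zero (Complex.ofReal_ne_zero.mpr (by linarith [hpos p hp0])) (mem_support_iff.mp hp)

omit [Fintype σ] [DecidableEq σ] in
/-- Congruence below `N` transports "`e` is the unique lightest support point" when `ω e < N`.
[folklore] -/
theorem strictMin_of_congr_below (ω : (σ →₀ ℕ) → ℝ) (A B : MvPolynomial σ ℂ) (N : ℝ)
    (hAB : ∀ p, ω p < N → coeff p A = coeff p B) (e : σ →₀ ℕ) (he : ω e < N)
    (h : e ∈ A.support ∧ ∀ e' ∈ A.support, e' ≠ e → ω e < ω e') :
    e ∈ B.support ∧ ∀ e' ∈ B.support, e' ≠ e → ω e < ω e' := by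
  obtain ⟨heA, hmin⟩ := h
  refine ⟨?_, fun e' he' hne => ?_⟩
  · rw [mem_support_iff, ← hAB e he]
    exact mem_support_iff.mp heA
  · by_cases h' : ω e' < N
    · refine hmin e' ?_ hne
      rw [mem_support_iff, hAB e' h']
      exact mem_support_iff.mp he'
    · linarith

omit [Fintype σ] in
/-- For `H` constant-free, `Q` with constant term `1` and Euler-type images `TH`, `TQ`:
`e` is the unique lightest support point of `TH * Q - H * TQ` iff it is for `H`. [folklore] -/
theorem strictMin_wronskian_iff (ω : (σ →₀ ℕ) → ℝ) (hadd : ∀ p q, ω (p + q) = ω p + ω q)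
    (hpos : ∀ p, p ≠ 0 → 1 ≤ ω p) (H Q TH TQ : MvPolynomial σ ℂ)
    (hTH : ∀ q, coeff q TH = (ω q : ℂ) * coeff q H) (hTQ : ∀ q, coeff q TQ = (ω q : ℂ) * coeff q Q)
    (hH : coeff 0 H = 0) (hQ : coeff 0 Q = 1) (e : σ →₀ ℕ) :
    (e ∈ (TH * Q - H * TQ).support ∧ ∀ e' ∈ (TH * Q - H * TQ).support, e' ≠ e → ω e < ω e') ↔
      (e ∈ H.support ∧ ∀ e' ∈ H.support, e' ≠ e → ω e < ω e') := by
  refine strictMin_transfer ω H (TH * Q - H * TQ) (fun p hp => ?_) (fun p hp hmin => ?_) e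
  · rcases Finset.mem_union.mp (support_sub _ _ _ hp) with hp1 | hp2
    · obtain ⟨q, hq, hq'⟩ := exists_support_left_of_mem_support_mul ω hadd hpos TH Q p hp1
      exact ⟨q, mem_support_of_mem_support_euler ω H TH hTH hq, hq'⟩
    · exact exists_support_left_of_mem_support_mul ω hadd hpos H TQ p hp2
  · have hp0 : p ≠ 0 := by rintro rfl; exact (mem_support_iff.mp hp) hH
    rw [mem_support_iff, coeff_sub, coeff_mul_of_isMin ω hadd hpos TH Q p
      (fun q hq => hmin q (mem_support_of_mem_support_euler ω H TH hTH hq)),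
      coeff_mul_of_isMin ω hadd hpos H TQ p hmin, hTQ 0, wt_zero ω hadd, hQ, hTH, mul_one,
      Complex.ofReal_zero, zero_mul, mul_zero, sub_zero]
    exact mul_ne_zero (Complex.ofReal_ne_zero.mpr (by linarith [hpos p hp0])) (mem_support_iff.mp hp)

omit [Fintype σ] [DecidableEq σ] in
/-- Exact derivative of the truncated logarithm: for any derivation `D`,
`D (∑_{s=1}^{R} ((-1)^(s+1)/s) • (u-1)^s) = D u * ∑_{t<R} (1-u)^t`. [folklore] -/
theorem deriv_logTrunc (D : Derivation ℂ (MvPolynomial σ ℂ) (MvPolynomial σ ℂ))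
    (u : MvPolynomial σ ℂ) (R : ℕ) :
    D (∑ s ∈ Finset.Icc 1 R, ((-1 : ℂ) ^ (s + 1) / (s : ℂ)) • (u - 1) ^ s) =
      D u * ∑ t ∈ Finset.range R, (1 - u) ^ t := by
  induction R with
  | zero => simp
  | succ R ih =>
    rw [Finset.sum_Icc_succ_top (by omega), map_add, ih, Finset.sum_range_succ, mul_add]
    congr 1
    rw [D.map_smul, D.leibniz_pow, Nat.add_sub_cancel, map_sub, D.map_one_eq_zero, sub_zero,
      smul_eq_mul, ← Nat.cast_smul_eq_nsmul ℂ, smul_smul,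
      div_mul_cancel₀ _ (Nat.cast_ne_zero.mpr (Nat.succ_ne_zero R)),
      MvPolynomial.smul_eq_C_mul, map_pow, map_neg, map_one,
      show ((1 : MvPolynomial σ ℂ) - u) ^ R = (-1) ^ R * (u - 1) ^ R by
        rw [← neg_pow, neg_sub]]
    ring

omit [Fintype σ] in
/-- For `u` with constant term `1`: `u * D (log_R u) ≡ D u` below weight `R`. [folklore] -/
theorem coeff_mul_deriv_logTrunc (ω : (σ →₀ ℕ) → ℝ) (hadd : ∀ p q, ω (p + q) = ω p + ω q)
    (hpos : ∀ p, p ≠ 0 → 1 ≤ ω p)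
    (D : Derivation ℂ (MvPolynomial σ ℂ) (MvPolynomial σ ℂ))
    (u : MvPolynomial σ ℂ) (hu : coeff 0 u = 1) (R : ℕ) :
    ∀ p, ω p < (R : ℝ) →
      coeff p (u * D (∑ s ∈ Finset.Icc 1 R, ((-1 : ℂ) ^ (s + 1) / (s : ℂ)) • (u - 1) ^ s)) =
        coeff p (D u) := by
  intro p hp
  have h0 : coeff 0 (1 - u) = 0 := by rw [coeff_sub, coeff_zero_one, hu, sub_self]
  rw [deriv_logTrunc, mul_left_comm,
    show u * ∑ t ∈ Finset.range R, (1 - u) ^ t = 1 - (1 - u) ^ R by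
      rw [← mul_neg_geom_sum, sub_sub_cancel],
    mul_sub, mul_one, coeff_sub,
    coeff_mul_congr_below ω hadd hpos R (D u) (D u) ((1 - u) ^ R) 0 (fun _ _ => rfl)
      (fun q hq => by rw [coeff_zero]; exact coeff_pow_eq_zero_below ω hadd hpos _ h0 R q hq) p hp,
    mul_zero, coeff_zero, sub_zero]

omit [Fintype σ] in
/-- For factors with constant term `1`: `(∏ u_i) * D (∑_r c_r • ∑_i (u_i-1)^r) ≡ D (∏ u_i)` below
weight `R`. [folklore] -/
theorem coeff_prod_mul_deriv_logTrunc (ω : (σ →₀ ℕ) → ℝ)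
    (hadd : ∀ p q, ω (p + q) = ω p + ω q) (hpos : ∀ p, p ≠ 0 → 1 ≤ ω p)
    (D : Derivation ℂ (MvPolynomial σ ℂ) (MvPolynomial σ ℂ)) {n : ℕ}
    (u : Fin n → MvPolynomial σ ℂ) (hu : ∀ i, coeff 0 (u i) = 1) (R : ℕ)
    (s : Finset (Fin n)) :
    ∀ p, ω p < (R : ℝ) →
      coeff p ((∏ i ∈ s, u i) *
          D (∑ r ∈ Finset.Icc 1 R, ((-1 : ℂ) ^ (r + 1) / (r : ℂ)) • ∑ i ∈ s, (u i - 1) ^ r)) =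
        coeff p (D (∏ i ∈ s, u i)) := by
  induction s using Finset.induction_on with
  | empty =>
    intro p _
    simp
  | insert a s ha ih =>
    intro p hp
    simp only [Finset.prod_insert ha, Finset.sum_insert ha, smul_add, Finset.sum_add_distrib,
      map_add, D.leibniz, smul_eq_mul]
    rw [show ∀ X Y : MvPolynomial σ ℂ, u a * (∏ i ∈ s, u i) * (X + Y) =
        u a * ((∏ i ∈ s, u i) * Y) + (∏ i ∈ s, u i) * (u a * X) from fun X Y => by ring,
      coeff_add, coeff_add,
      coeff_mul_congr_below ω hadd hpos R (u a) (u a) _ _ (fun _ _ => rfl) ih p hp,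
      coeff_mul_congr_below ω hadd hpos R (∏ i ∈ s, u i) (∏ i ∈ s, u i) _ _ (fun _ _ => rfl)
        (coeff_mul_deriv_logTrunc ω hadd hpos D (u a) (hu a) R) p hp]

omit [Fintype σ] in
/-- `D (P - Q) * Q - (P - Q) * D Q ≡ P * Q * D Λ_R` below weight `R`. [folklore] -/
theorem coeff_wronskian_congr (ω : (σ →₀ ℕ) → ℝ) (hadd : ∀ p q, ω (p + q) = ω p + ω q)
    (hpos : ∀ p, p ≠ 0 → 1 ≤ ω p)
    (D : Derivation ℂ (MvPolynomial σ ℂ) (MvPolynomial σ ℂ)) {n : ℕ}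
    (u v : Fin n → MvPolynomial σ ℂ) (hu : ∀ i, coeff 0 (u i) = 1)
    (hv : ∀ i, coeff 0 (v i) = 1) (R : ℕ) :
    ∀ p, ω p < (R : ℝ) →
      coeff p (D (∏ i, u i - ∏ i, v i) * (∏ i, v i) - (∏ i, u i - ∏ i, v i) * D (∏ i, v i)) =
        coeff p ((∏ i, u i) * (∏ i, v i) *
          D (∑ r ∈ Finset.Icc 1 R, ((-1 : ℂ) ^ (r + 1) / (r : ℂ)) •
            (∑ i, (u i - 1) ^ r - ∑ i, (v i - 1) ^ r))) := by
  intro p hp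
  simp only [smul_sub, Finset.sum_sub_distrib, map_sub]
  rw [show ∀ A B X Y : MvPolynomial σ ℂ, A * B * (X - Y) = B * (A * X) - A * (B * Y) from
      fun _ _ _ _ => by ring,
    show ∀ A B A' B' : MvPolynomial σ ℂ, (A' - B') * B - (A - B) * B' = B * A' - A * B' from
      fun _ _ _ _ => by ring,
    coeff_sub, coeff_sub,
    coeff_mul_congr_below ω hadd hpos R (∏ i, v i) (∏ i, v i) _ _ (fun _ _ => rfl)
      (coeff_prod_mul_deriv_logTrunc ω hadd hpos D u hu R Finset.univ) p hp,
    coeff_mul_congr_below ω hadd hpos R (∏ i, u i) (∏ i, u i) _ _ (fun _ _ => rfl)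
      (coeff_prod_mul_deriv_logTrunc ω hadd hpos D v hv R Finset.univ) p hp]

omit [Fintype σ] in
/-- Abstract chain: if `P`, `Q` have constant term `1`, `Λ` is constant-free, and
`D (P - Q) * Q - (P - Q) * D Q ≡ P * Q * D Λ` below `R` for an Euler-type derivation `D`, then for
`ω e < R`: `e` is the unique lightest support point of `P - Q` iff it is for `Λ`. [folklore] -/
theorem strictMin_sub_iff_of_congr (ω : (σ →₀ ℕ) → ℝ) (hadd : ∀ p q, ω (p + q) = ω p + ω q)
    (hpos : ∀ p, p ≠ 0 → 1 ≤ ω p)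
    (D : Derivation ℂ (MvPolynomial σ ℂ) (MvPolynomial σ ℂ))
    (hD : ∀ A q, coeff q (D A) = (ω q : ℂ) * coeff q A) (P Q Λ : MvPolynomial σ ℂ)
    (hP : coeff 0 P = 1) (hQ : coeff 0 Q = 1) (hΛ : coeff 0 Λ = 0) (R : ℕ)
    (hcong : ∀ p, ω p < (R : ℝ) → coeff p (D (P - Q) * Q - (P - Q) * D Q) = coeff p (P * Q * D Λ))
    (e : σ →₀ ℕ) (he : ω e < (R : ℝ)) :
    (e ∈ (P - Q).support ∧ ∀ e' ∈ (P - Q).support, e' ≠ e → ω e < ω e') ↔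
      (e ∈ Λ.support ∧ ∀ e' ∈ Λ.support, e' ≠ e → ω e < ω e') := by
  have hPQ : coeff 0 (P - Q) = 0 := by rw [coeff_sub, hP, hQ, sub_self]
  have hPQ1 : coeff 0 (P * Q) = 1 := by
    rw [coeff_mul_of_isMin ω hadd hpos P Q 0 (fun q _ => ?_), hP, hQ, mul_one]
    rw [wt_zero ω hadd]
    exact wt_nonneg ω hadd hpos q
  refine (strictMin_wronskian_iff ω hadd hpos (P - Q) Q (D (P - Q)) (D Q) (hD _) (hD _) hPQ hQ
    e).symm.trans ?_
  refine ⟨fun h => ?_, fun h => ?_⟩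
  · have h' := strictMin_of_congr_below ω _ _ (R : ℝ) hcong e he h
    rw [mul_comm (P * Q) (D Λ)] at h'
    exact (strictMin_euler_mul_iff ω hadd hpos Λ (D Λ) (P * Q) (hD Λ) hΛ hPQ1 e).mp h'
  · refine strictMin_of_congr_below ω _ _ (R : ℝ) (fun p hp => (hcong p hp).symm) e he ?_
    rw [mul_comm (P * Q) (D Λ)]
    exact (strictMin_euler_mul_iff ω hadd hpos Λ (D Λ) (P * Q) (hD Λ) hΛ hPQ1 e).mpr h


omit [Fintype σ] [DecidableEq σ] in
/-- One summand of the real Euler derivation on a monomial. [folklore] -/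
theorem monomial_tsub_smul_wX (θ : σ → ℝ) (s : σ →₀ ℕ) (i : σ) :
    (monomial (s - Finsupp.single i 1) ((s i : ℕ) : ℂ) : MvPolynomial σ ℂ) •
        (((θ i : ℝ) : ℂ) • (X i : MvPolynomial σ ℂ)) =
      (((θ i : ℝ) : ℂ) * ((s i : ℕ) : ℂ)) • monomial s (1 : ℂ) := by
  rw [smul_eq_mul, mul_smul_comm, mul_smul]
  congr 1
  by_cases h : s i = 0
  · simp [h]
  · rw [X, monomial_mul, mul_one,
      tsub_add_cancel_of_le (Finsupp.single_le_iff.mpr (Nat.one_le_iff_ne_zero.mpr h)),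
      smul_monomial, smul_eq_mul, mul_one]

/-- The real linear weight `q ↦ Σ θ_i q_i`. [folklore] -/
def lwt (θ : σ → ℝ) (q : σ →₀ ℕ) : ℝ := ∑ i, θ i * ((q i : ℕ) : ℝ)

omit [DecidableEq σ] in
/-- `lwt_add` (R3 toolkit). [folklore] -/
theorem lwt_add (θ : σ → ℝ) (p q : σ →₀ ℕ) : lwt θ (p + q) = lwt θ p + lwt θ q := by
  unfold lwt
  rw [← Finset.sum_add_distrib]
  refine Finset.sum_congr rfl fun i _ => ?_
  simp only [Finsupp.coe_add, Pi.add_apply]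
  push_cast
  ring

omit [DecidableEq σ] in
/-- A weight with all `θ_i ≥ 1` is `≥ 1` on nonzero exponents. [folklore] -/
theorem one_le_lwt_of_ne_zero (θ : σ → ℝ) (hθ : ∀ i, 1 ≤ θ i) (p : σ →₀ ℕ) (hp : p ≠ 0) :
    1 ≤ lwt θ p := by
  obtain ⟨i, hi⟩ : ∃ i, p i ≠ 0 := by
    by_contra h
    push Not at h
    exact hp (Finsupp.ext fun i => by simpa using h i)
  unfold lwt
  have h1 : (1 : ℝ) ≤ θ i * ((p i : ℕ) : ℝ) := by
    have : (1 : ℝ) ≤ ((p i : ℕ) : ℝ) := by exact_mod_cast Nat.one_le_iff_ne_zero.mpr hi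
    nlinarith [hθ i]
  calc (1 : ℝ) ≤ θ i * ((p i : ℕ) : ℝ) := h1
    _ ≤ ∑ k, θ k * ((p k : ℕ) : ℝ) :=
        Finset.single_le_sum (f := fun k => θ k * ((p k : ℕ) : ℝ))
          (fun k _ => mul_nonneg (by linarith [hθ k]) (Nat.cast_nonneg _)) (Finset.mem_univ i)

/-- Coefficient formula for the real Euler derivation `θ_D = ∑ i, θ i • X i ∂_i`:
`coeff q (θ_D A) = (Σ θ_i q_i) * coeff q A`. [folklore] -/
theorem coeff_eulerDerivation (θ : σ → ℝ) (A : MvPolynomial σ ℂ) (q : σ →₀ ℕ) :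
    coeff q (MvPolynomial.mkDerivation ℂ
        (fun i : σ => ((θ i : ℝ) : ℂ) • (X i : MvPolynomial σ ℂ)) A) =
      ((lwt θ q : ℝ) : ℂ) * coeff q A := by
  induction A using MvPolynomial.induction_on' with
  | monomial s a =>
    rw [MvPolynomial.mkDerivation_monomial, Finsupp.sum_fintype _ _ (fun i => by simp)]
    rw [Finset.sum_congr rfl fun i _ => monomial_tsub_smul_wX θ s i, ← Finset.sum_smul, smul_smul,
      coeff_smul, coeff_monomial, coeff_monomial]
    split_ifs with h
    · subst h
      unfold lwt
      push_cast
      rw [smul_eq_mul]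
      ring
    · rw [smul_zero, mul_zero]
  | add p q hp hq => rw [map_add, coeff_add, coeff_add, hp, hq, mul_add]

omit [Fintype σ] [DecidableEq σ] in
/-- `coeff_zero_prod_eq_one` (R3 toolkit). [folklore] -/
theorem coeff_zero_prod_eq_one {n : ℕ} (u : Fin n → MvPolynomial σ ℂ)
    (hu : ∀ i, coeff 0 (u i) = 1) : coeff 0 (∏ i, u i) = 1 := by
  rw [← constantCoeff_eq, map_prod]
  exact Finset.prod_eq_one fun i _ => by rw [constantCoeff_eq]; exact hu i

omit [Fintype σ] [DecidableEq σ] in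
/-- The truncated log-difference is constant-free. [folklore] -/
theorem coeff_zero_logTrunc {n : ℕ} (u v : Fin n → MvPolynomial σ ℂ)
    (hu : ∀ i, coeff 0 (u i) = 1) (hv : ∀ i, coeff 0 (v i) = 1) (R : ℕ) :
    coeff 0 (∑ r ∈ Finset.Icc 1 R, ((-1 : ℂ) ^ (r + 1) / (r : ℂ)) •
        (∑ i, (u i - 1) ^ r - ∑ i, (v i - 1) ^ r)) = 0 := by
  have hu' : ∀ i, constantCoeff (u i) = 1 := fun i => by rw [constantCoeff_eq]; exact hu i
  have hv' : ∀ i, constantCoeff (v i) = 1 := fun i => by rw [constantCoeff_eq]; exact hv i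
  rw [← constantCoeff_eq, map_sum]
  refine Finset.sum_eq_zero fun r _ => ?_
  rw [constantCoeff_smul, map_sub, map_sum, map_sum]
  simp [hu', hv']



/-! ## Part C: linear forms, moments, and the truncated logarithm's coefficients -/

/-- The linear form `Σ a_i Y_i`. [folklore] -/
def lin (a : σ → ℂ) : MvPolynomial σ ℂ := ∑ i, a i • X i

/-- The moment `a^κ = ∏ a_i ^ κ_i`. [folklore] -/
def mom (a : σ → ℂ) (κ : σ →₀ ℕ) : ℂ := ∏ i, a i ^ κ i

/-- Total degree of an exponent. [folklore] -/
def deg (κ : σ →₀ ℕ) : ℕ := κ.sum fun _ k => k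

omit [DecidableEq σ] in
/-- `deg_eq_sum` (R3 toolkit). [folklore] -/
theorem deg_eq_sum (κ : σ →₀ ℕ) : deg κ = ∑ i, κ i := by
  unfold deg; exact Finsupp.sum_fintype _ _ (fun _ => rfl)

omit [DecidableEq σ] in
/-- `deg_eq_zero_iff` (R3 toolkit). [folklore] -/
theorem deg_eq_zero_iff (κ : σ →₀ ℕ) : deg κ = 0 ↔ κ = 0 := by
  rw [deg_eq_sum]
  constructor
  · intro h
    ext i
    have := (Finset.sum_eq_zero_iff.mp h) i (Finset.mem_univ i)
    simpa using this
  · rintro rfl; simp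

omit [DecidableEq σ] in
/-- `coeff_lin_pow` (R3 toolkit). [folklore] -/
theorem coeff_lin_pow (a : σ → ℂ) (κ : σ →₀ ℕ) (n : ℕ) :
    coeff κ (lin a ^ n) = if deg κ = n then (κ.multinomial : ℂ) * mom a κ else 0 := by
  unfold lin mom deg
  rw [coeff_linearCombination_X_pow_of_fintype]
  split_ifs with h
  · rw [Finsupp.prod_fintype _ _ (fun i => by simp)]
  · rfl

omit [DecidableEq σ] in
/-- `coeff_zero_lin` (R3 toolkit). [folklore] -/
theorem coeff_zero_lin (a : σ → ℂ) : coeff 0 (lin a) = 0 := by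
  have := coeff_lin_pow a 0 1
  rw [pow_one] at this
  rw [this, if_neg]
  rw [deg_eq_sum]; simp

omit [DecidableEq σ] in
/-- `coeff_zero_one_add_lin` (R3 toolkit). [folklore] -/
theorem coeff_zero_one_add_lin (a : σ → ℂ) : coeff 0 (1 + lin a) = 1 := by
  rw [coeff_add, coeff_zero_lin, coeff_zero_one, add_zero]

omit [Fintype σ] [DecidableEq σ] in
/-- `multinomial_cast_ne_zero` (R3 toolkit). [folklore] -/
theorem multinomial_cast_ne_zero (κ : σ →₀ ℕ) : (κ.multinomial : ℂ) ≠ 0 := by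
  rw [Finsupp.multinomial_eq]
  exact Nat.cast_ne_zero.mpr (Nat.pos_iff_ne_zero.mp (Nat.multinomial_pos _ _))

/-- The truncated log-difference of the chain, for tails `lin (c j)`, `lin (d j)`. [folklore] -/
def logTrunc {m : ℕ} (c d : Fin m → σ → ℂ) (R : ℕ) : MvPolynomial σ ℂ :=
  ∑ r ∈ Finset.Icc 1 R, ((-1 : ℂ) ^ (r + 1) / (r : ℂ)) •
    (∑ j, ((1 + lin (c j)) - 1) ^ r - ∑ j, ((1 + lin (d j)) - 1) ^ r)

omit [DecidableEq σ] in
/-- `coeff_logTrunc` (R3 toolkit). [folklore] -/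
theorem coeff_logTrunc {m : ℕ} (c d : Fin m → σ → ℂ) (R : ℕ) (κ : σ →₀ ℕ) (h1 : 1 ≤ deg κ)
    (hR : deg κ ≤ R) :
    coeff κ (logTrunc c d R) =
      ((-1 : ℂ) ^ (deg κ + 1) / (deg κ : ℂ)) * ((κ.multinomial : ℂ) *
        (∑ j, mom (c j) κ - ∑ j, mom (d j) κ)) := by
  unfold logTrunc
  simp only [add_sub_cancel_left]
  rw [coeff_sum]
  rw [Finset.sum_eq_single (deg κ)]
  · rw [coeff_smul, coeff_sub, coeff_sum, coeff_sum, smul_eq_mul]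
    congr 1
    simp only [coeff_lin_pow, if_true]
    rw [mul_sub, Finset.mul_sum, Finset.mul_sum]
  · intro r _ hr
    rw [coeff_smul, coeff_sub, coeff_sum, coeff_sum, smul_eq_mul]
    simp only [coeff_lin_pow, if_neg (Ne.symm hr), Finset.sum_const_zero, sub_zero, mul_zero]
  · intro h
    exfalso; exact h (Finset.mem_Icc.mpr ⟨h1, hR⟩)

omit [DecidableEq σ] in
/-- `mem_support_logTrunc_iff` (R3 toolkit). [folklore] -/
theorem mem_support_logTrunc_iff {m : ℕ} (c d : Fin m → σ → ℂ) (R : ℕ) (κ : σ →₀ ℕ) (h1 : 1 ≤ deg κ)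
    (hR : deg κ ≤ R) :
    κ ∈ (logTrunc c d R).support ↔ ∑ j, mom (c j) κ ≠ ∑ j, mom (d j) κ := by
  rw [mem_support_iff, coeff_logTrunc c d R κ h1 hR]
  have hk : (deg κ : ℂ) ≠ 0 := Nat.cast_ne_zero.mpr (by omega)
  have hc : ((-1 : ℂ) ^ (deg κ + 1) / (deg κ : ℂ)) ≠ 0 :=
    div_ne_zero (pow_ne_zero _ (neg_ne_zero.mpr one_ne_zero)) hk
  rw [mul_ne_zero_iff, mul_ne_zero_iff, sub_ne_zero]
  exact ⟨fun h => h.2.2, fun h => ⟨hc, multinomial_cast_ne_zero κ, h⟩⟩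

omit [DecidableEq σ] in
/-- `mom_zero` (R3 toolkit). [folklore] -/
theorem mom_zero (a : σ → ℂ) : mom a 0 = 1 := by unfold mom; simp

omit [DecidableEq σ] in
/-- `deg κ ≤ Σ θ_i κ_i` when all `θ_i ≥ 1`. [folklore] -/
theorem deg_le_lwt (θ : σ → ℝ) (hθ : ∀ i, 1 ≤ θ i) (κ : σ →₀ ℕ) : (deg κ : ℝ) ≤ lwt θ κ := by
  rw [deg_eq_sum]; unfold lwt; push_cast
  exact Finset.sum_le_sum fun i _ => by nlinarith [hθ i, (Nat.cast_nonneg (κ i) : (0:ℝ) ≤ (κ i : ℝ))]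

/-! ## Part D1: the lifted log-linearisation — a strict `θ`-minimum of the lifted support is the strict `θ`-minimal
unequal moment -/

/-- The lifted difference of products `∏ (1 + Σ c_{ji} Y_i) − ∏ (1 + Σ d_{ji} Y_i)`. [folklore] -/
def liftG {m : ℕ} (c d : Fin m → σ → ℂ) : MvPolynomial σ ℂ :=
  ∏ j, (1 + lin (c j)) - ∏ j, (1 + lin (d j))

/-- `lifted_minUnequal` (R3 toolkit). [folklore] -/
theorem lifted_minUnequal {m : ℕ} (θ : σ → ℝ) (hθ : ∀ i, 1 ≤ θ i) (c d : Fin m → σ → ℂ) (κ₀ : σ →₀ ℕ)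
    (h : κ₀ ∈ (liftG c d).support ∧ ∀ κ ∈ (liftG c d).support, κ ≠ κ₀ → lwt θ κ₀ < lwt θ κ) :
    (∑ j, mom (c j) κ₀ ≠ ∑ j, mom (d j) κ₀) ∧
      ∀ κ : σ →₀ ℕ, κ ≠ κ₀ → (∑ j, mom (c j) κ ≠ ∑ j, mom (d j) κ) → lwt θ κ₀ < lwt θ κ := by
  have hadd := lwt_add θ
  have hpos := one_le_lwt_of_ne_zero θ hθ
  set R : ℕ := ⌊lwt θ κ₀⌋₊ + 1 with hRdef
  have hR : lwt θ κ₀ < (R : ℝ) := by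
    rw [hRdef]; push_cast; exact Nat.lt_floor_add_one _
  have hu : ∀ j, coeff 0 (1 + lin (c j)) = 1 := fun j => coeff_zero_one_add_lin (c j)
  have hv : ∀ j, coeff 0 (1 + lin (d j)) = 1 := fun j => coeff_zero_one_add_lin (d j)
  have key := strictMin_sub_iff_of_congr (lwt θ) hadd hpos
    (MvPolynomial.mkDerivation ℂ fun i : σ => ((θ i : ℝ) : ℂ) • (X i : MvPolynomial σ ℂ))
    (coeff_eulerDerivation θ) (∏ j, (1 + lin (c j))) (∏ j, (1 + lin (d j))) (logTrunc c d R)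
    (coeff_zero_prod_eq_one _ hu) (coeff_zero_prod_eq_one _ hv) (coeff_zero_logTrunc _ _ hu hv R) R
    (coeff_wronskian_congr _ hadd hpos _ _ _ hu hv R) κ₀ hR
  have h' : κ₀ ∈ (logTrunc c d R).support ∧ ∀ κ ∈ (logTrunc c d R).support, κ ≠ κ₀ → lwt θ κ₀ < lwt θ κ :=
    key.mp h
  -- degree facts
  have hκ₀ne : κ₀ ≠ 0 := by
    intro h0
    have := mem_support_iff.mp h.1
    rw [h0] at this
    apply this
    unfold liftG
    rw [coeff_sub, coeff_zero_prod_eq_one _ hu, coeff_zero_prod_eq_one _ hv, sub_self]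
  have hdeg1 : 1 ≤ deg κ₀ := by
    rcases Nat.eq_zero_or_pos (deg κ₀) with h0 | h0
    · exact absurd ((deg_eq_zero_iff κ₀).mp h0) hκ₀ne
    · exact h0
  have hdegR : deg κ₀ ≤ R := by
    have := deg_le_lwt θ hθ κ₀
    have : (deg κ₀ : ℝ) < R := lt_of_le_of_lt this hR
    exact_mod_cast this.le
  refine ⟨(mem_support_logTrunc_iff c d R κ₀ hdeg1 hdegR).mp h'.1, fun κ hne hneq => ?_⟩
  by_contra hle
  push Not at hle
  have hκne : κ ≠ 0 := by
    rintro rfl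
    apply hneq
    simp [mom_zero]
  have hk1 : 1 ≤ deg κ := by
    rcases Nat.eq_zero_or_pos (deg κ) with h0 | h0
    · exact absurd ((deg_eq_zero_iff κ).mp h0) hκne
    · exact h0
  have hkR : deg κ ≤ R := by
    have h1 := deg_le_lwt θ hθ κ
    have : (deg κ : ℝ) < R := by linarith
    exact_mod_cast this.le
  have hmem : κ ∈ (logTrunc c d R).support := (mem_support_logTrunc_iff c d R κ hk1 hkR).mpr hneq
  linarith [h'.2 κ hmem hne]


/-! ## Part D2: push-forward `Y_i ↦ X^{E i}` to the plane, its coefficient formula, injectivity and degrees -/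

section PushForward
variable (E : σ → (Fin 2 →₀ ℕ))

/-- The letter substitution `Y_i ↦ X^{E i}`. [folklore] -/
def phi : MvPolynomial σ ℂ →ₐ[ℂ] MvPolynomial (Fin 2) ℂ :=
  aeval fun i => (monomial (E i) (1 : ℂ) : MvPolynomial (Fin 2) ℂ)

/-- The induced map on exponents `κ ↦ Σ κ_i • E i`. [folklore] -/
def piE (κ : σ →₀ ℕ) : Fin 2 →₀ ℕ := κ.sum fun i k => k • E i

omit [DecidableEq σ] in
/-- `piE_eq_sum` (R3 toolkit). [folklore] -/
theorem piE_eq_sum (κ : σ →₀ ℕ) : piE E κ = ∑ i, κ i • E i := by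
  unfold piE; exact Finsupp.sum_fintype _ _ (fun _ => by simp)

omit [Fintype σ] [DecidableEq σ] in
/-- `phi_monomial` (R3 toolkit). [folklore] -/
theorem phi_monomial (κ : σ →₀ ℕ) (a : ℂ) : phi E (monomial κ a) = monomial (piE E κ) a := by
  unfold phi piE
  rw [aeval_monomial, monomial_finsupp_sum_index]
  rw [MvPolynomial.algebraMap_eq]
  congr 1
  refine Finsupp.prod_congr fun i _ => ?_
  rw [monomial_pow, one_pow]

omit [Fintype σ] [DecidableEq σ] in
/-- `phi_eq_sum` (R3 toolkit). [folklore] -/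
theorem phi_eq_sum (H : MvPolynomial σ ℂ) : phi E H = ∑ κ ∈ H.support, monomial (piE E κ) (coeff κ H) := by
  conv_lhs => rw [as_sum H]
  rw [map_sum]
  exact Finset.sum_congr rfl fun κ _ => phi_monomial E κ _

omit [Fintype σ] [DecidableEq σ] in
/-- `coeff_phi` (R3 toolkit). [folklore] -/
theorem coeff_phi (H : MvPolynomial σ ℂ) (n : Fin 2 →₀ ℕ) :
    coeff n (phi E H) = ∑ κ ∈ H.support with piE E κ = n, coeff κ H := by
  classical
  rw [phi_eq_sum, coeff_sum, Finset.sum_filter]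
  refine Finset.sum_congr rfl fun κ _ => ?_
  rw [coeff_monomial]

omit [Fintype σ] [DecidableEq σ] in
/-- `exists_of_mem_support_phi` (R3 toolkit). [folklore] -/
theorem exists_of_mem_support_phi (H : MvPolynomial σ ℂ) (n : Fin 2 →₀ ℕ) (hn : n ∈ (phi E H).support) :
    ∃ κ ∈ H.support, piE E κ = n := by
  classical
  rw [mem_support_iff, coeff_phi] at hn
  obtain ⟨κ, hκ, -⟩ := Finset.exists_ne_zero_of_sum_ne_zero hn
  exact ⟨κ, (Finset.mem_filter.mp hκ).1, (Finset.mem_filter.mp hκ).2⟩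

omit [Fintype σ] [DecidableEq σ] in
/-- `coeff_phi_of_injOn` (R3 toolkit). [folklore] -/
theorem coeff_phi_of_injOn (H : MvPolynomial σ ℂ) (hinj : Set.InjOn (piE E) ↑H.support) (κ : σ →₀ ℕ)
    (hκ : κ ∈ H.support) : coeff (piE E κ) (phi E H) = coeff κ H := by
  classical
  rw [coeff_phi]
  have hfil : (H.support.filter fun κ' => piE E κ' = piE E κ) = {κ} := by
    ext κ'
    simp only [Finset.mem_filter, Finset.mem_singleton]
    constructor
    · rintro ⟨h1, h2⟩; exact hinj h1 hκ h2
    · rintro rfl; exact ⟨hκ, rfl⟩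
  rw [hfil, Finset.sum_singleton]

omit [DecidableEq σ] in
/-- `phi_lin` (R3 toolkit). [folklore] -/
theorem phi_lin (a : σ → ℂ) : phi E (lin a) = ∑ i, monomial (E i) (a i) := by
  unfold lin
  rw [map_sum]
  refine Finset.sum_congr rfl fun i _ => ?_
  rw [map_smul, show (X i : MvPolynomial σ ℂ) = monomial (Finsupp.single i 1) 1 from rfl, phi_monomial]
  rw [piE, Finsupp.sum_single_index (by simp), one_smul, smul_monomial, smul_eq_mul, mul_one]

/-- Injectivity on exponents of degree `≤ h` (the lifted form of the `B_h` property). [folklore] -/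
def InjDeg (h : ℕ) : Prop :=
  ∀ κ κ' : σ →₀ ℕ, deg κ ≤ h → deg κ' ≤ h → piE E κ = piE E κ' → κ = κ'

omit [Fintype σ] [DecidableEq σ] in
/-- `InjDeg` from the `B_h` property of the alphabet `T ⊇ range E`, `E` injective. [folklore] -/
theorem injDeg_of_isBm (h : ℕ) (T : Finset (Fin 2 →₀ ℕ)) (hE : Function.Injective E) (hET : ∀ i, E i ∈ T)
    (hBm : ∀ ν ν' : (Fin 2 →₀ ℕ) →₀ ℕ, ν.support ⊆ T → ν'.support ⊆ T →
      (ν.sum fun _ k => k) ≤ h → (ν'.sum fun _ k => k) ≤ h →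
      (ν.sum fun e k => k • e) = (ν'.sum fun e k => k • e) → ν = ν') :
    InjDeg E h := by
  classical
  intro κ κ' hκ hκ' hπ
  have hsupp : ∀ κ : σ →₀ ℕ, (Finsupp.mapDomain E κ).support ⊆ T := fun κ => by
    intro e he
    obtain ⟨i, -, rfl⟩ := Finset.mem_image.mp (Finsupp.mapDomain_support he)
    exact hET i
  have hdeg : ∀ κ : σ →₀ ℕ, ((Finsupp.mapDomain E κ).sum fun _ k => k) = deg κ := fun κ => by
    unfold deg
    exact Finsupp.sum_mapDomain_index (fun _ => rfl) (fun _ _ _ => rfl)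
  have hsum : ∀ κ : σ →₀ ℕ, ((Finsupp.mapDomain E κ).sum fun e k => k • e) = piE E κ := fun κ => by
    unfold piE
    exact Finsupp.sum_mapDomain_index (fun _ => zero_smul _ _) (fun _ _ _ => add_smul _ _ _)
  have := hBm (Finsupp.mapDomain E κ) (Finsupp.mapDomain E κ') (hsupp κ) (hsupp κ')
    (by rw [hdeg]; exact hκ) (by rw [hdeg]; exact hκ') (by rw [hsum, hsum]; exact hπ)
  exact Finsupp.mapDomain_injective hE this

end PushForward

omit [DecidableEq σ] in
/-- Degree bound: exponents of the lifted difference have degree `≤ m`. [folklore] -/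
theorem deg_le_of_mem_support_liftG {m : ℕ} (c d : Fin m → σ → ℂ) (κ : σ →₀ ℕ)
    (hκ : κ ∈ (liftG c d).support) : deg κ ≤ m := by
  have hlin : ∀ a : σ → ℂ, (1 + lin a).totalDegree ≤ 1 := fun a => by
    refine (totalDegree_add _ _).trans (max_le (by simp) ?_)
    unfold lin
    refine totalDegree_finsetSum_le fun i _ => ?_
    refine (totalDegree_smul_le _ _).trans ?_
    nontriviality ℂ
    rw [totalDegree_X]
  have hprod : ∀ a : Fin m → σ → ℂ, (∏ j, (1 + lin (a j))).totalDegree ≤ m := fun a => by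
    refine (totalDegree_finsetProd _ _).trans ?_
    calc ∑ j, (1 + lin (a j)).totalDegree ≤ ∑ _j : Fin m, 1 := Finset.sum_le_sum fun j _ => hlin (a j)
      _ = m := by simp
  have hG : (liftG c d).totalDegree ≤ m := by
    unfold liftG
    exact (totalDegree_sub _ _).trans (max_le (hprod c) (hprod d))
  exact (le_totalDegree hκ).trans hG


/-! ## Part D3: the planar instance as a push-forward of the lifted one; visible points are lifted strict minima -/

section Planar
open Summit.ValiantsHypothesis.ValiantsHypothesis.Theorems.NewtonUnitEquations.TwoProducts.FormalLogLinearisation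
open Summit.ValiantsHypothesis.ValiantsHypothesis.Theorems.NewtonUnitEquations.TwoProducts.PlanarCell

/-- `wt_piE` (R3 toolkit). [folklore] -/
theorem wt_piE {s : ℕ} (ξ : Fin 2 → ℝ) (E : Fin s → Expo) (κ : Fin s →₀ ℕ) :
    wt ξ (piE E κ) = ∑ i, (κ i : ℝ) * wt ξ (E i) := by
  rw [piE_eq_sum, wt_sum]
  exact Finset.sum_congr rfl fun i _ => wt_nsmul ξ (κ i) (E i)

/-- `lwt_eq_neg_wt` (R3 toolkit). [folklore] -/
theorem lwt_eq_neg_wt {s : ℕ} (ξ : Fin 2 → ℝ) (E : Fin s → Expo) (κ : Fin s →₀ ℕ) :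
    lwt (fun i => -wt ξ (E i)) κ = -wt ξ (piE E κ) := by
  unfold lwt
  rw [wt_piE, ← Finset.sum_neg_distrib]
  exact Finset.sum_congr rfl fun i _ => by ring

variable {m : ℕ} (u v : Fin m → MvPolynomial (Fin 2) ℂ)

/-- Number of tail letters. [folklore] -/
def sE : ℕ := (tailSupport u v).card

/-- Enumeration of the tail alphabet. [folklore] -/
def enum (i : Fin (sE u v)) : Expo := (((tailSupport u v).equivFin.symm i : ↥(tailSupport u v)) : Expo)

/-- `enum_mem` (R3 toolkit). [folklore] -/
theorem enum_mem (i : Fin (sE u v)) : enum u v i ∈ tailSupport u v :=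
  ((tailSupport u v).equivFin.symm i).2

/-- `enum_injective` (R3 toolkit). [folklore] -/
theorem enum_injective : Function.Injective (enum u v) := by
  intro i j h
  have : (tailSupport u v).equivFin.symm i = (tailSupport u v).equivFin.symm j := Subtype.ext h
  exact (tailSupport u v).equivFin.symm.injective this

/-- `sum_enum` (R3 toolkit). [folklore] -/
theorem sum_enum {M : Type*} [AddCommMonoid M] (f : Expo → M) :
    ∑ i, f (enum u v i) = ∑ e ∈ tailSupport u v, f e := by
  rw [← Finset.sum_coe_sort (tailSupport u v) f]
  exact Equiv.sum_comp (tailSupport u v).equivFin.symm (fun x : ↥(tailSupport u v) => f (x : Expo))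

/-- Lifted coefficient matrices. [folklore] -/
def cU (j : Fin m) (i : Fin (sE u v)) : ℂ := coeff (enum u v i) (u j)
/-- `cV` (R3 toolkit). [folklore] -/
def cV (j : Fin m) (i : Fin (sE u v)) : ℂ := coeff (enum u v i) (v j)

/-- `support_u_subset` (R3 toolkit). [folklore] -/
theorem support_u_subset (j : Fin m) : (u j).support ⊆ tailSupport u v := by
  intro e he; unfold tailSupport
  exact Finset.mem_union_left _ (Finset.mem_biUnion.mpr ⟨j, Finset.mem_univ _, he⟩)

/-- `support_v_subset` (R3 toolkit). [folklore] -/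
theorem support_v_subset (j : Fin m) : (v j).support ⊆ tailSupport u v := by
  intro e he; unfold tailSupport
  exact Finset.mem_union_right _ (Finset.mem_biUnion.mpr ⟨j, Finset.mem_univ _, he⟩)

/-- `eq_sum_monomial_of_subset` (R3 toolkit). [folklore] -/
theorem eq_sum_monomial_of_subset (p : MvPolynomial (Fin 2) ℂ) (T : Finset Expo) (hT : p.support ⊆ T) :
    p = ∑ e ∈ T, monomial e (coeff e p) := by
  conv_lhs => rw [as_sum p]
  refine Finset.sum_subset hT fun e _ he => ?_
  rw [notMem_support_iff.mp he, monomial_zero]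

/-- `phi_lin_cU` (R3 toolkit). [folklore] -/
theorem phi_lin_cU (j : Fin m) : phi (enum u v) (lin (cU u v j)) = u j := by
  rw [phi_lin]
  unfold cU
  rw [sum_enum u v (fun e => monomial e (coeff e (u j)))]
  exact (eq_sum_monomial_of_subset (u j) _ (support_u_subset u v j)).symm

/-- `phi_lin_cV` (R3 toolkit). [folklore] -/
theorem phi_lin_cV (j : Fin m) : phi (enum u v) (lin (cV u v j)) = v j := by
  rw [phi_lin]
  unfold cV
  rw [sum_enum u v (fun e => monomial e (coeff e (v j)))]
  exact (eq_sum_monomial_of_subset (v j) _ (support_v_subset u v j)).symm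

/-- `phi_liftG` (R3 toolkit). [folklore] -/
theorem phi_liftG : phi (enum u v) (liftG (cU u v) (cV u v)) = tailDiff u v := by
  unfold liftG tailDiff
  rw [map_sub, map_prod, map_prod]
  simp only [map_add, map_one, phi_lin_cU, phi_lin_cV]

/-- Letters are nonzero exponents (tails are constant-free). [folklore] -/
theorem enum_ne_zero (hu : ∀ j, coeff 0 (u j) = 0) (hv : ∀ j, coeff 0 (v j) = 0) (i : Fin (sE u v)) :
    enum u v i ≠ 0 := by
  intro h0
  have hmem := enum_mem u v i
  rw [h0] at hmem
  unfold tailSupport at hmem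
  rcases Finset.mem_union.mp hmem with h | h
  · obtain ⟨j, -, hj⟩ := Finset.mem_biUnion.mp h
    exact (mem_support_iff.mp hj) (hu j)
  · obtain ⟨j, -, hj⟩ := Finset.mem_biUnion.mp h
    exact (mem_support_iff.mp hj) (hv j)

/-- Valid weights are negative on letters. [folklore] -/
theorem wt_enum_neg (ξ : Fin 2 → ℝ) (hval : ValidWeight u v ξ) (i : Fin (sE u v)) : wt ξ (enum u v i) < 0 := by
  have hmem := enum_mem u v i
  unfold tailSupport at hmem
  rcases Finset.mem_union.mp hmem with h | h
  · obtain ⟨j, -, hj⟩ := Finset.mem_biUnion.mp h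
    exact hval.1 j _ hj
  · obtain ⟨j, -, hj⟩ := Finset.mem_biUnion.mp h
    exact hval.2 j _ hj

/-- `IsBm` (route-file form) ⇒ injectivity of `piE enum` in degree `≤ m`. [folklore] -/
theorem injDeg_enum (hBm : ∀ ν ν' : Expo →₀ ℕ, ν.support ⊆ tailSupport u v → ν'.support ⊆ tailSupport u v →
      (ν.sum fun _ k => k) ≤ m → (ν'.sum fun _ k => k) ≤ m →
      (ν.sum fun e k => k • e) = (ν'.sum fun e k => k • e) → ν = ν') :
    InjDeg (enum u v) m :=
  injDeg_of_isBm (enum u v) m (tailSupport u v) (enum_injective u v) (enum_mem u v) hBm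

/-- `injOn_support_liftG` (R3 toolkit). [folklore] -/
theorem injOn_support_liftG (hBm : InjDeg (enum u v) m) :
    Set.InjOn (piE (enum u v)) ↑(liftG (cU u v) (cV u v)).support := by
  intro κ hκ κ' hκ' h
  exact hBm κ κ' (deg_le_of_mem_support_liftG _ _ κ hκ) (deg_le_of_mem_support_liftG _ _ κ' hκ') h

/-- A planar visible point lifts to a strict `ξ`-extremum of the lifted support. [folklore] -/
theorem lifted_of_visible (hinj : Set.InjOn (piE (enum u v)) ↑(liftG (cU u v) (cV u v)).support) (ξ : Fin 2 → ℝ)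
    (l : Expo) (htop : IsStrictTop ξ ↑(tailDiff u v).support l) :
    ∃ κ₀ : Fin (sE u v) →₀ ℕ, κ₀ ∈ (liftG (cU u v) (cV u v)).support ∧ piE (enum u v) κ₀ = l ∧
      ∀ κ ∈ (liftG (cU u v) (cV u v)).support, κ ≠ κ₀ → wt ξ (piE (enum u v) κ) < wt ξ l := by
  have hsupp : (tailDiff u v) = phi (enum u v) (liftG (cU u v) (cV u v)) := (phi_liftG u v).symm
  obtain ⟨hl, hlt⟩ := htop
  have hl' : l ∈ (phi (enum u v) (liftG (cU u v) (cV u v))).support := by rw [← hsupp]; exact hl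
  obtain ⟨κ₀, hκ₀, hπ⟩ := exists_of_mem_support_phi (enum u v) _ l hl'
  refine ⟨κ₀, hκ₀, hπ, fun κ hκ hne => ?_⟩
  have hcoeff : coeff (piE (enum u v) κ) (tailDiff u v) ≠ 0 := by
    rw [hsupp, coeff_phi_of_injOn (enum u v) _ hinj κ hκ]
    exact mem_support_iff.mp hκ
  have hneπ : piE (enum u v) κ ≠ l := by
    intro h
    exact hne (hinj hκ hκ₀ (h.trans hπ.symm))
  exact hlt _ (mem_support_iff.mpr hcoeff) hneπ

/-- **Lemma A, planar form.** Under injectivity of the push-forward on the lifted support, a planar visible point `l` (valid `ξ`) lifts to `κ₀` with `piE κ₀ = l` which is an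
UNEQUAL MOMENT and the strict `ξ`-extremal one: every other unequal moment `κ` has `wt ξ (piE κ) < wt ξ l`. [folklore] -/
theorem minUnequal_of_visible (hinj : Set.InjOn (piE (enum u v)) ↑(liftG (cU u v) (cV u v)).support) (ξ : Fin 2 → ℝ)
    (hval : ValidWeight u v ξ) (l : Expo) (htop : IsStrictTop ξ ↑(tailDiff u v).support l) :
    ∃ κ₀ : Fin (sE u v) →₀ ℕ, piE (enum u v) κ₀ = l ∧
      (∑ j, mom (cU u v j) κ₀ ≠ ∑ j, mom (cV u v j) κ₀) ∧
      ∀ κ : Fin (sE u v) →₀ ℕ, κ ≠ κ₀ → (∑ j, mom (cU u v j) κ ≠ ∑ j, mom (cV u v j) κ) →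
        wt ξ (piE (enum u v) κ) < wt ξ (piE (enum u v) κ₀) := by
  obtain ⟨κ₀, hκ₀, hπ, hmin⟩ := lifted_of_visible u v hinj ξ l htop
  -- positive weights θ_i = -wt ξ (E i), rescaled to be ≥ 1
  have hθpos : ∀ i, 0 < -wt ξ (enum u v i) := fun i => by linarith [wt_enum_neg u v ξ hval i]
  -- the index type is nonempty (κ₀ ≠ 0)
  have hκ₀ne : κ₀ ≠ 0 := by
    intro h0
    have := mem_support_iff.mp hκ₀
    apply this
    rw [h0]; unfold liftG
    rw [coeff_sub, coeff_zero_prod_eq_one _ (fun j => coeff_zero_one_add_lin _),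
      coeff_zero_prod_eq_one _ (fun j => coeff_zero_one_add_lin _), sub_self]
  obtain ⟨i₀, -⟩ : ∃ i, κ₀ i ≠ 0 := by
    by_contra h; push Not at h; exact hκ₀ne (Finsupp.ext fun i => by simpa using h i)
  have hne : (Finset.univ : Finset (Fin (sE u v))).Nonempty := ⟨i₀, Finset.mem_univ _⟩
  set θmin : ℝ := Finset.univ.inf' hne (fun i => -wt ξ (enum u v i)) with hθmin
  have hθmin_pos : 0 < θmin := by
    obtain ⟨i, -, hi⟩ := Finset.exists_mem_eq_inf' hne (fun i => -wt ξ (enum u v i))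
    rw [hθmin, hi]; exact hθpos i
  have hθmin_le : ∀ i, θmin ≤ -wt ξ (enum u v i) := fun i => Finset.inf'_le _ (Finset.mem_univ i)
  set θ' : Fin (sE u v) → ℝ := fun i => -wt ξ (enum u v i) / θmin with hθ'
  have hθ'1 : ∀ i, 1 ≤ θ' i := fun i => by
    rw [hθ']; exact (one_le_div hθmin_pos).mpr (hθmin_le i)
  have hlwt' : ∀ κ : Fin (sE u v) →₀ ℕ, lwt θ' κ = (-wt ξ (piE (enum u v) κ)) / θmin := fun κ => by
    rw [← lwt_eq_neg_wt]; unfold lwt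
    rw [Finset.sum_div]
    exact Finset.sum_congr rfl fun i _ => by rw [hθ']; ring
  have hstrict : κ₀ ∈ (liftG (cU u v) (cV u v)).support ∧
      ∀ κ ∈ (liftG (cU u v) (cV u v)).support, κ ≠ κ₀ → lwt θ' κ₀ < lwt θ' κ := by
    refine ⟨hκ₀, fun κ hκ hne => ?_⟩
    rw [hlwt', hlwt', hπ]
    exact div_lt_div_of_pos_right (by linarith [hmin κ hκ hne]) hθmin_pos
  obtain ⟨h1, h2⟩ := lifted_minUnequal θ' hθ'1 (cU u v) (cV u v) κ₀ hstrict
  refine ⟨κ₀, hπ, h1, fun κ hne hneq => ?_⟩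
  have := h2 κ hne hneq
  rw [hlwt', hlwt'] at this
  have := (div_lt_div_iff_of_pos_right hθmin_pos).mp this
  linarith

end Planar


/-! ## Part D4: the pencil of normalised valid weights, and the count -/

section Pencil
open Summit.ValiantsHypothesis.ValiantsHypothesis.Theorems.NewtonUnitEquations.TwoProducts.FormalLogLinearisation

/-- `wt_weight_div` (R3 toolkit). [folklore] -/
theorem wt_weight_div (ξ : Fin 2 → ℝ) (r : ℝ) (e : Expo) : wt (fun k => ξ k / r) e = wt ξ e / r := by
  unfold wt; ring

/-- All weights normalised by `wt ζ e₀ = -1` lie on one affine line `β + ℝ τ` (as functionals on exponents). [folklore] -/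
theorem pencil_param (e₀ : Expo) (he₀ : e₀ ≠ 0) :
    ∃ β τ : Fin 2 → ℝ, ∀ ζ : Fin 2 → ℝ, wt ζ e₀ = -1 → ∃ c : ℝ, ∀ e : Expo, wt ζ e = wt β e + c * wt τ e := by
  set p : ℝ := ((e₀ 0 : ℕ) : ℝ) with hp
  set q : ℝ := ((e₀ 1 : ℕ) : ℝ) with hq
  have hp0 : 0 ≤ p := Nat.cast_nonneg _
  have hq0 : 0 ≤ q := Nat.cast_nonneg _
  have hpq : 0 < p + q := by
    have h : e₀ 0 ≠ 0 ∨ e₀ 1 ≠ 0 := by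
      by_contra h
      push Not at h
      exact he₀ (by ext i; fin_cases i <;> simp [h.1, h.2])
    rcases h with h | h
    · have : (1 : ℝ) ≤ p := by rw [hp]; exact_mod_cast Nat.one_le_iff_ne_zero.mpr h
      linarith
    · have : (1 : ℝ) ≤ q := by rw [hq]; exact_mod_cast Nat.one_le_iff_ne_zero.mpr h
      linarith
  have hN : 0 < p ^ 2 + q ^ 2 := by
    have : 0 < (p + q) ^ 2 := by positivity
    nlinarith [mul_nonneg hp0 hq0]
  have hpq' : p + q ≠ 0 := hpq.ne'
  have hN' : p ^ 2 + q ^ 2 ≠ 0 := hN.ne'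
  refine ⟨fun _ => -1 / (p + q), ![q, -p], fun ζ hζ => ?_⟩
  have hζ' : ζ 0 * p + ζ 1 * q = -1 := by unfold wt at hζ; rw [hp, hq]; exact hζ
  set d0 : ℝ := ζ 0 + 1 / (p + q) with hd0
  set d1 : ℝ := ζ 1 + 1 / (p + q) with hd1
  have hd : d0 * p + d1 * q = 0 := by
    rw [hd0, hd1]
    have : (ζ 0 + 1 / (p + q)) * p + (ζ 1 + 1 / (p + q)) * q = (ζ 0 * p + ζ 1 * q) + (p + q) / (p + q) := by
      field_simp
      ring
    rw [this, hζ', div_self hpq']; ring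
  set c : ℝ := (d0 * q - d1 * p) / (p ^ 2 + q ^ 2) with hc
  have hc0 : d0 = c * q := by
    rw [hc, div_mul_eq_mul_div, eq_div_iff hN']
    linear_combination p * hd
  have hc1 : d1 = -(c * p) := by
    have key : d1 * (p ^ 2 + q ^ 2) = -((d0 * q - d1 * p) * p) := by linear_combination q * hd
    have : d1 = d1 * (p ^ 2 + q ^ 2) / (p ^ 2 + q ^ 2) := by field_simp
    rw [this, key, hc]
    ring
  refine ⟨c, fun e => ?_⟩
  unfold wt
  simp only [Matrix.cons_val_zero, Matrix.cons_val_one]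
  have h0 : ζ 0 = -1 / (p + q) + c * q := by
    have : ζ 0 = d0 - 1 / (p + q) := by rw [hd0]; ring
    rw [this, hc0]; ring
  have h1 : ζ 1 = -1 / (p + q) + c * (-p) := by
    have : ζ 1 = d1 - 1 / (p + q) := by rw [hd1]; ring
    rw [this, hc1]; ring
  rw [h0, h1]; ring

end Pencil


section Count
open Summit.ValiantsHypothesis.ValiantsHypothesis.Theorems.NewtonUnitEquations.TwoProducts.FormalLogLinearisation
open Summit.ValiantsHypothesis.ValiantsHypothesis.Theorems.NewtonUnitEquations.TwoProducts.PlanarCell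

variable {m : ℕ}

/-- `tailSupport_nonempty_of_mem` (R3 toolkit). [folklore] -/
theorem tailSupport_nonempty_of_mem (u v : Fin m → MvPolynomial (Fin 2) ℂ) (l : Expo)
    (hl : l ∈ (tailDiff u v).support) : (tailSupport u v).Nonempty := by
  by_contra h
  rw [Finset.not_nonempty_iff_eq_empty] at h
  have hu : ∀ j, u j = 0 := fun j => by
    have h' := support_u_subset u v j
    rw [h, Finset.subset_empty] at h'
    exact support_eq_empty.mp h'
  have hv : ∀ j, v j = 0 := fun j => by
    have h' := support_v_subset u v j
    rw [h, Finset.subset_empty] at h'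
    exact support_eq_empty.mp h'
  apply mem_support_iff.mp hl
  unfold tailDiff
  simp [hu, hv]

/-- **The lifted count.** If the push-forward `Y_e ↦ X^e` is injective on the support of the lifted difference
`∏(1+U_j) − ∏(1+V_j)`, then GLOBALLY `#visible ≤ 2^{13m}(#T+2)^2`. [folklore] -/
theorem count_of_injOn :
    ∀ (m : ℕ) (u v : Fin m → MvPolynomial (Fin 2) ℂ), (∀ j, coeff 0 (u j) = 0) → (∀ j, coeff 0 (v j) = 0) →
    Set.InjOn (piE (enum u v)) ↑(liftG (cU u v) (cV u v)).support →
    ∀ S : Finset Expo, (∀ l ∈ S, ∃ ξ : Fin 2 → ℝ, ValidWeight u v ξ ∧ IsStrictTop ξ ↑(tailDiff u v).support l) →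
      S.card ≤ 2 ^ (13 * m) * ((tailSupport u v).card + 2) ^ 2 := by
  intro m u v hu0 hv0 hInj S hS
  rcases S.eq_empty_or_nonempty with hSe | hSne
  · simp [hSe]
  obtain ⟨l₀, hl₀⟩ := hSne
  obtain ⟨ξ₀, hval₀, htop₀⟩ := hS l₀ hl₀
  have hm : 1 ≤ m := by
    rcases Nat.eq_zero_or_pos m with h | h
    · exfalso
      subst h
      apply mem_support_iff.mp htop₀.1
      unfold tailDiff
      simp
    · exact h
  have hTne : (tailSupport u v).Nonempty := tailSupport_nonempty_of_mem u v l₀ htop₀.1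
  have hsE : 0 < sE u v := Finset.card_pos.mpr hTne
  set e₀ : Expo := enum u v ⟨0, hsE⟩ with he₀def
  have he₀ : e₀ ≠ 0 := enum_ne_zero u v hu0 hv0 _
  obtain ⟨β, τ, hpencil⟩ := pencil_param e₀ he₀
  -- choices along `S`
  have hξ : ∀ x : ↥S, ∃ ξ : Fin 2 → ℝ, ValidWeight u v ξ ∧ IsStrictTop ξ ↑(tailDiff u v).support x.1 :=
    fun x => hS x.1 x.2
  choose ξf hξval hξtop using hξ
  have hκ : ∀ x : ↥S, ∃ κ₀ : Fin (sE u v) →₀ ℕ, piE (enum u v) κ₀ = x.1 ∧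
      (∑ j, mom (cU u v j) κ₀ ≠ ∑ j, mom (cV u v j) κ₀) ∧
      ∀ κ : Fin (sE u v) →₀ ℕ, κ ≠ κ₀ → (∑ j, mom (cU u v j) κ ≠ ∑ j, mom (cV u v j) κ) →
        wt (ξf x) (piE (enum u v) κ) < wt (ξf x) (piE (enum u v) κ₀) :=
    fun x => minUnequal_of_visible u v hInj (ξf x) (hξval x) x.1 (hξtop x)
  choose κf hκπ hκne hκmin using hκ
  -- normalisation radii `r x = -wt ξ_x e₀ > 0`
  have hrpos : ∀ x : ↥S, 0 < -wt (ξf x) e₀ := fun x => by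
    linarith [wt_enum_neg u v (ξf x) (hξval x) ⟨0, hsE⟩]
  have hnorm : ∀ x : ↥S, wt (fun k => ξf x k / (-wt (ξf x) e₀)) e₀ = -1 := fun x => by
    rw [wt_weight_div]
    have hne : wt (ξf x) e₀ ≠ 0 := by linarith [hrpos x]
    rw [div_neg, div_self hne]
  have hc : ∀ x : ↥S, ∃ c : ℝ, ∀ e : Expo, wt (fun k => ξf x k / (-wt (ξf x) e₀)) e = wt β e + c * wt τ e :=
    fun x => hpencil _ (hnorm x)
  choose cf hcf using hc
  -- shift the pencil parameter to be positive on `S`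
  have hSne' : (Finset.univ : Finset ↥S).Nonempty := ⟨⟨l₀, hl₀⟩, Finset.mem_univ _⟩
  set cmin : ℝ := Finset.univ.inf' hSne' cf - 1 with hcmin
  have hcc : ∀ x : ↥S, 1 ≤ cf x - cmin := fun x => by
    have := Finset.inf'_le cf (Finset.mem_univ x)
    rw [hcmin]; linarith
  set θ₂ : Fin (sE u v) → ℝ := fun i => -wt τ (enum u v i) with hθ₂
  set θ₁ : Fin (sE u v) → ℝ := fun i => -wt β (enum u v i) + cmin * θ₂ i with hθ₁
  have hθ : ∀ (x : ↥S) (i : Fin (sE u v)),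
      θ₁ i + (cf x - cmin) * θ₂ i = -wt (ξf x) (enum u v i) / (-wt (ξf x) e₀) := fun x i => by
    have h := hcf x (enum u v i)
    rw [wt_weight_div] at h
    rw [hθ₁, hθ₂]
    simp only
    rw [neg_div, h]
    ring
  have hsumθ : ∀ (x : ↥S) (ν : Fin (sE u v) → ℕ),
      ∑ i, (θ₁ i + (cf x - cmin) * θ₂ i) * (ν i : ℝ) =
        -wt (ξf x) (piE (enum u v) (Finsupp.equivFunOnFinite.symm ν)) / (-wt (ξf x) e₀) := fun x ν => by
    rw [wt_piE]
    simp only [Finsupp.coe_equivFunOnFinite_symm]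
    rw [eq_div_iff (hrpos x).ne', Finset.sum_mul, ← Finset.sum_neg_distrib]
    have hne : wt (ξf x) e₀ ≠ 0 := by linarith [hrpos x]
    refine Finset.sum_congr rfl fun i _ => ?_
    rw [hθ x i]
    field_simp
  -- lifted points, injective on `S`
  set liftPt : ↥S → (Fin (sE u v) → ℕ) := fun x => ⇑(κf x) with hliftPt
  have hinjL : Function.Injective liftPt := by
    intro x y h
    have hκ : κf x = κf y := DFunLike.coe_injective h
    apply Subtype.ext
    rw [← hκπ x, ← hκπ y, hκ]
  -- the hypothesis of the lifted pencil count
  have hhyp : ∀ μ ∈ (Finset.univ : Finset ↥S).image liftPt,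
      (∑ j, ∏ i, cU u v j i ^ μ i) ≠ (∑ j, ∏ i, cV u v j i ^ μ i) ∧
      ∃ c : ℝ, 0 < c ∧ ∀ ν : Fin (sE u v) → ℕ, ν ≠ μ →
        (∑ j, ∏ i, cU u v j i ^ ν i) ≠ (∑ j, ∏ i, cV u v j i ^ ν i) →
          ∑ i, (θ₁ i + c * θ₂ i) * (μ i : ℝ) < ∑ i, (θ₁ i + c * θ₂ i) * (ν i : ℝ) := by
    intro μ hμ
    obtain ⟨x, -, rfl⟩ := Finset.mem_image.mp hμ
    refine ⟨?_, cf x - cmin, by linarith [hcc x], fun ν hν hneq => ?_⟩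
    · have := hκne x
      unfold mom at this
      exact this
    · have hν' : Finsupp.equivFunOnFinite.symm ν ≠ κf x := by
        intro h
        apply hν
        rw [hliftPt]
        simp only
        rw [← h, Finsupp.coe_equivFunOnFinite_symm]
      have hneq' : ∑ j, mom (cU u v j) (Finsupp.equivFunOnFinite.symm ν) ≠
          ∑ j, mom (cV u v j) (Finsupp.equivFunOnFinite.symm ν) := by
        unfold mom
        simpa only [Finsupp.coe_equivFunOnFinite_symm] using hneq
      have hlt := hκmin x _ hν' hneq'
      rw [hsumθ x, hsumθ x ν]
      have hμ' : Finsupp.equivFunOnFinite.symm (liftPt x) = κf x := by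
        rw [hliftPt]; exact Finsupp.equivFunOnFinite_symm_coe (κf x)
      rw [hμ']
      exact div_lt_div_of_pos_right (by linarith) (hrpos x)
  have hbound := liftedPencilCount_bound (cU u v) (cV u v) θ₁ θ₂ _ hhyp
  have hcardS : ((Finset.univ : Finset ↥S).image liftPt).card = S.card := by
    rw [Finset.card_image_of_injective _ hinjL, Finset.card_univ, Fintype.card_coe]
  calc S.card = ((Finset.univ : Finset ↥S).image liftPt).card := hcardS.symm
    _ ≤ 2 * (sE u v * sE u v + 1) * ((Nat.log 2 (2 * m) + 1) * (2 * m) ^ (2 * Nat.log 2 (2 * m))) := hbound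
    _ ≤ 2 ^ (13 * m) * (sE u v + 2) ^ 2 := liftedPencilCount_arith m (sE u v) hm
    _ = 2 ^ (13 * m) * ((tailSupport u v).card + 2) ^ 2 := rfl


/-- **R3 (permutation-type law via the `B_m` alphabet).** [folklore] -/
theorem permutationTypeLaw_proof :
    ∀ (m : ℕ) (u v : Fin m → MvPolynomial (Fin 2) ℂ), (∀ j, coeff 0 (u j) = 0) → (∀ j, coeff 0 (v j) = 0) →
    (∀ ν ν' : Expo →₀ ℕ, ν.support ⊆ tailSupport u v → ν'.support ⊆ tailSupport u v →
      (ν.sum fun _ k => k) ≤ m → (ν'.sum fun _ k => k) ≤ m →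
      (ν.sum fun e k => k • e) = (ν'.sum fun e k => k • e) → ν = ν') →
    ∀ S : Finset Expo, (∀ l ∈ S, ∃ ξ : Fin 2 → ℝ, ValidWeight u v ξ ∧ IsStrictTop ξ ↑(tailDiff u v).support l) →
      S.card ≤ 2 ^ (13 * m) * ((tailSupport u v).card + 2) ^ 2 :=
  fun m u v hu0 hv0 hBm S hS =>
    count_of_injOn m u v hu0 hv0 (injOn_support_liftG u v (injDeg_enum u v hBm)) S hS

end Count

/-! ## Part G: FAMILY-LEVEL permutation type (R3♯)

The injectivity of the push-forward on the lifted support follows from the POSITION-AWARE `B_m`-type hypothesis (equivalent to `IsBm m A` on identical supports `A_j = A`, strictly weaker only for heterogeneous supports) that every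
additive coincidence of the letter family `A` (two `0`-filled letter tuples with the same sum) is of permutation type (same
multiset of nonzero letters).  This contains dissociated families (p603804), `B_m` alphabets (R3) and block-merged confined
families (R2⁺) as special cases. -/

section SupportProd

omit [Fintype σ] in
/-- Support of a linear form: single letters with nonzero coefficient. [folklore] -/
theorem mem_support_lin [Fintype σ] (c : σ → ℂ) (κ : σ →₀ ℕ) (h : κ ∈ (lin c).support) :
    ∃ i, c i ≠ 0 ∧ κ = Finsupp.single i 1 := by
  classical
  unfold lin at h
  obtain ⟨i, -, hi⟩ := Finset.mem_biUnion.1 (support_sum h)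
  rw [mem_support_iff, coeff_smul, coeff_X, smul_eq_mul] at hi
  by_cases hκ : Finsupp.single i 1 = κ
  · refine ⟨i, ?_, hκ.symm⟩
    rw [if_pos hκ, mul_one] at hi
    exact hi
  · rw [if_neg hκ, mul_zero] at hi
    exact absurd rfl hi

/-- Support of `1 + (linear form)`: zero or a single letter with nonzero coefficient. [folklore] -/
theorem mem_support_one_add_lin (c : σ → ℂ) (κ : σ →₀ ℕ) (h : κ ∈ (1 + lin c).support) :
    κ = 0 ∨ ∃ i, c i ≠ 0 ∧ κ = Finsupp.single i 1 := by
  classical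
  rcases Finset.mem_union.1 (support_add h) with h1 | h2
  · left
    rw [mem_support_iff, coeff_one] at h1
    split_ifs at h1 with h0
    · exact h0.symm
    · exact absurd rfl h1
  · exact Or.inr (mem_support_lin c κ h2)

/-- Support of `∏_{j ∈ s} (1 + U_j)`: sums of one optional letter per position. [folklore] -/
theorem exists_tuple_of_mem_support_prod {m : ℕ} (c : Fin m → σ → ℂ) (s : Finset (Fin m)) :
    ∀ κ ∈ (∏ j ∈ s, (1 + lin (c j))).support, ∃ g : Fin m → (σ →₀ ℕ),
      (∀ j, g j = 0 ∨ ∃ i, c j i ≠ 0 ∧ g j = Finsupp.single i 1) ∧ (∀ j ∉ s, g j = 0) ∧ ∑ j ∈ s, g j = κ := by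
  classical
  induction s using Finset.induction_on with
  | empty =>
    intro κ hκ
    rw [Finset.prod_empty, mem_support_iff, coeff_one] at hκ
    split_ifs at hκ with h0
    · exact ⟨fun _ => 0, fun j => Or.inl rfl, fun j _ => rfl, by simp [← h0]⟩
    · exact absurd rfl hκ
  | insert a s ha ih =>
    intro κ hκ
    rw [Finset.prod_insert ha] at hκ
    obtain ⟨κ₁, hκ₁, κ₂, hκ₂, rfl⟩ := Finset.mem_add.1 (support_mul _ _ hκ)
    obtain ⟨g, hg, hgs, hsum⟩ := ih κ₂ hκ₂
    refine ⟨Function.update g a κ₁, ?_, ?_, ?_⟩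
    · intro j
      by_cases hj : j = a
      · subst hj
        rw [Function.update_self]
        exact mem_support_one_add_lin (c j) κ₁ hκ₁
      · rw [Function.update_of_ne hj]
        exact hg j
    · intro j hj
      rw [Finset.mem_insert, not_or] at hj
      rw [Function.update_of_ne hj.1]
      exact hgs j hj.2
    · rw [Finset.sum_insert ha, Function.update_self, ← hsum]
      congr 1
      refine Finset.sum_congr rfl fun j hj => ?_
      have hja : j ≠ a := by
        rintro rfl
        exact ha hj
      rw [Function.update_of_ne hja]

end SupportProd

section PermType
open Summit.ValiantsHypothesis.ValiantsHypothesis.Theorems.NewtonUnitEquations.TwoProducts.FormalLogLinearisation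
open Summit.ValiantsHypothesis.ValiantsHypothesis.Theorems.NewtonUnitEquations.TwoProducts.PlanarCell

variable {m : ℕ}

/-- The LETTER MULTISET of a `0`-filled letter tuple (the zeros forgotten). [folklore] -/
def msetT (a : Fin m → Expo) : Expo →₀ ℕ := ∑ j, if a j = 0 then 0 else Finsupp.single (a j) 1

/-- All coincidences of the letter family `A` are of PERMUTATION TYPE: equal sums ⇒ equal letter multisets. [folklore] -/
def PermType (A : Fin m → Finset Expo) : Prop :=
  ∀ a ∈ tuples A, ∀ b ∈ tuples A, ∑ j, a j = ∑ j, b j → msetT a = msetT b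

variable (u v : Fin m → MvPolynomial (Fin 2) ℂ)

/-- `piE_eq_linearCombination` (R3 toolkit). [folklore] -/
theorem piE_eq_linearCombination {s : ℕ} (E : Fin s → Expo) (κ : Fin s →₀ ℕ) :
    piE E κ = Finsupp.linearCombination ℕ E κ := (Finsupp.linearCombination_apply ℕ κ).symm

/-- `piE_single'` (R3 toolkit). [folklore] -/
theorem piE_single' {s : ℕ} (E : Fin s → Expo) (i : Fin s) : piE E (Finsupp.single i 1) = E i := by
  rw [piE_eq_linearCombination, Finsupp.linearCombination_single, one_smul]

/-- `piE_zero'` (R3 toolkit). [folklore] -/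
theorem piE_zero' {s : ℕ} (E : Fin s → Expo) : piE E 0 = 0 := by
  rw [piE_eq_linearCombination, map_zero]

/-- `piE_finset_sum` (R3 toolkit). [folklore] -/
theorem piE_finset_sum {s : ℕ} (E : Fin s → Expo) (g : Fin m → (Fin s →₀ ℕ)) :
    piE E (∑ j, g j) = ∑ j, piE E (g j) := by
  simp only [piE_eq_linearCombination, map_sum]

/-- A lifted support point of `∏(1 + U_j)` comes from a letter tuple of the family, with matching point and multiset. [folklore] -/
theorem tuple_of_mem_support_prod (hu : ∀ j, coeff 0 (u j) = 0) (hv : ∀ j, coeff 0 (v j) = 0)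
    (A : Fin m → Finset Expo) (c : Fin m → Fin (sE u v) → ℂ) (hc : ∀ j i, c j i ≠ 0 → enum u v i ∈ A j)
    (κ : Fin (sE u v) →₀ ℕ) (hκ : κ ∈ (∏ j, (1 + lin (c j))).support) :
    ∃ a ∈ tuples A, ∑ j, a j = piE (enum u v) κ ∧ msetT a = Finsupp.mapDomain (enum u v) κ := by
  classical
  obtain ⟨g, hg, -, hsum⟩ := exists_tuple_of_mem_support_prod c Finset.univ κ (by simpa using hκ)
  refine ⟨fun j => piE (enum u v) (g j), ?_, ?_, ?_⟩
  · refine Fintype.mem_piFinset.2 fun j => ?_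
    rcases hg j with h | ⟨i, hi, h⟩
    · rw [h, piE_zero']
      exact Finset.mem_insert_self _ _
    · rw [h, piE_single']
      exact Finset.mem_insert_of_mem (hc j i hi)
  · rw [← hsum, piE_finset_sum]
  · rw [← hsum, Finsupp.mapDomain_finsetSum]
    unfold msetT
    refine Finset.sum_congr rfl fun j _ => ?_
    show (if piE (enum u v) (g j) = 0 then 0 else Finsupp.single (piE (enum u v) (g j)) 1) =
      Finsupp.mapDomain (enum u v) (g j)
    rcases hg j with h | ⟨i, hi, h⟩
    · rw [h, piE_zero', if_pos rfl, Finsupp.mapDomain_zero]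
    · rw [h, piE_single', if_neg (enum_ne_zero u v hu hv i), Finsupp.mapDomain_single]

/-- **Family-level permutation type ⇒ the push-forward is injective on the lifted support.** [folklore] -/
theorem injOn_of_permType (hu : ∀ j, coeff 0 (u j) = 0) (hv : ∀ j, coeff 0 (v j) = 0)
    (A : Fin m → Finset Expo) (huA : ∀ j, (u j).support ⊆ A j) (hvA : ∀ j, (v j).support ⊆ A j)
    (hperm : PermType A) :
    Set.InjOn (piE (enum u v)) ↑(liftG (cU u v) (cV u v)).support := by
  classical
  have hcU : ∀ j i, cU u v j i ≠ 0 → enum u v i ∈ A j := fun j i h => huA j (mem_support_iff.mpr h)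
  have hcV : ∀ j i, cV u v j i ≠ 0 → enum u v i ∈ A j := fun j i h => hvA j (mem_support_iff.mpr h)
  have key : ∀ κ ∈ (liftG (cU u v) (cV u v)).support,
      ∃ a ∈ tuples A, ∑ j, a j = piE (enum u v) κ ∧ msetT a = Finsupp.mapDomain (enum u v) κ := by
    intro κ hκ
    unfold liftG at hκ
    rcases Finset.mem_union.1 (support_sub _ _ _ hκ) with h | h
    · exact tuple_of_mem_support_prod u v hu hv A (cU u v) hcU κ h
    · exact tuple_of_mem_support_prod u v hu hv A (cV u v) hcV κ h
  intro κ hκ κ' hκ' hπ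
  obtain ⟨a, ha, haS, haM⟩ := key κ hκ
  obtain ⟨b, hb, hbS, hbM⟩ := key κ' hκ'
  have hab : msetT a = msetT b := hperm a ha b hb (by rw [haS, hbS]; exact hπ)
  rw [haM, hbM] at hab
  exact Finsupp.mapDomain_injective (enum_injective u v) hab

/-- **R3♯ (family-level permutation-type law).** If every additive coincidence of the letter family
`A_j = supp u_j ∪ supp v_j` is of permutation type, then GLOBALLY `#visible ≤ 2^{13m}(#T+2)^2`. [folklore] -/
theorem permTypeLaw_proof :
    ∀ (m : ℕ) (u v : Fin m → MvPolynomial (Fin 2) ℂ), (∀ j, coeff 0 (u j) = 0) → (∀ j, coeff 0 (v j) = 0) →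
    PermType (fun j => (u j).support ∪ (v j).support) →
    ∀ S : Finset Expo, (∀ l ∈ S, ∃ ξ : Fin 2 → ℝ, ValidWeight u v ξ ∧ IsStrictTop ξ ↑(tailDiff u v).support l) →
      S.card ≤ 2 ^ (13 * m) * ((tailSupport u v).card + 2) ^ 2 :=
  fun m u v hu0 hv0 hperm S hS =>
    count_of_injOn m u v hu0 hv0
      (injOn_of_permType u v hu0 hv0 _ (fun _ => Finset.subset_union_left) (fun _ => Finset.subset_union_right) hperm) S hS

/-- Dissociated families (`Σ` injective on letter tuples, p603804's hypothesis) are of permutation type. [folklore] -/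
theorem permType_of_injOn (A : Fin m → Finset Expo) (h : Set.InjOn (fun a : Fin m → Expo => ∑ j, a j) ↑(tuples A)) :
    PermType A := by
  intro a ha b hb hab
  have : a = b := h (Finset.mem_coe.2 ha) (Finset.mem_coe.2 hb) hab
  rw [this]

end PermType


/-- `T ⊆ ℕ²` is a `B_h`-set in the strong sense: multisets of at most `h` letters of `T` are determined by their sums (verbatim the
line's `IsBm`). [folklore] -/
def IsBm (h : ℕ) (T : Finset (Fin 2 →₀ ℕ)) : Prop :=
  ∀ ν ν' : (Fin 2 →₀ ℕ) →₀ ℕ, ν.support ⊆ T → ν'.support ⊆ T →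
    (ν.sum fun _ k => k) ≤ h → (ν'.sum fun _ k => k) ≤ h →
    (ν.sum fun e k => k • e) = (ν'.sum fun e k => k • e) → ν = ν'

section Statement
open Summit.ValiantsHypothesis.ValiantsHypothesis.Theorems.NewtonUnitEquations.TwoProducts.FormalLogLinearisation
open Summit.ValiantsHypothesis.ValiantsHypothesis.Theorems.NewtonUnitEquations.TwoProducts.PlanarCell

/-- **Permutation-type law (rung R3 of the line `relation_ladder`, verbatim its `PermutationTypeLaw`).** For constant-free tails
`u, v : Fin m → ℂ[x,y]` whose tail alphabet `T = tailSupport u v` is a `B_m`-set, the number of exponents that are the strict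
`ξ`-top of `supp(∏(1+u_j) − ∏(1+v_j))` for some valid weight `ξ` is at most `2^{13m} (#T+2)^2`. [folklore] -/
theorem visibleCount_of_isBm :
    ∀ (m : ℕ) (u v : Fin m → MvPolynomial (Fin 2) ℂ), (∀ j, coeff 0 (u j) = 0) → (∀ j, coeff 0 (v j) = 0) →
    IsBm m (tailSupport u v) →
    ∀ S : Finset Expo, (∀ l ∈ S, ∃ ξ : Fin 2 → ℝ, ValidWeight u v ξ ∧ IsStrictTop ξ ↑(tailDiff u v).support l) →
      S.card ≤ 2 ^ (13 * m) * ((tailSupport u v).card + 2) ^ 2 :=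
  fun m u v hu hv hBm S hS => permutationTypeLaw_proof m u v hu hv hBm S hS

/-- **Family-level permutation-type law (rung R3♯ of the line `relation_ladder`, verbatim its `PermTypeLaw`).** If every
additive coincidence of the letter family `A_j = supp u_j ∪ supp v_j` — two `0`-filled letter tuples with the same sum — is of
permutation type (`PermType`: equal letter multisets), then the number of exponents that are the strict `ξ`-top of
`supp(∏(1+u_j) − ∏(1+v_j))` for some valid weight `ξ` is at most `2^{13m} (#T+2)^2`.  Contains the dissociated regime of
`planarCell_dissociated_linear` (p603804; `permType_of_injOn`) as a GLOBAL bound, and `visibleCount_of_isBm`. [folklore] -/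
theorem visibleCount_of_permType :
    ∀ (m : ℕ) (u v : Fin m → MvPolynomial (Fin 2) ℂ), (∀ j, coeff 0 (u j) = 0) → (∀ j, coeff 0 (v j) = 0) →
    PermType (fun j => (u j).support ∪ (v j).support) →
    ∀ S : Finset Expo, (∀ l ∈ S, ∃ ξ : Fin 2 → ℝ, ValidWeight u v ξ ∧ IsStrictTop ξ ↑(tailDiff u v).support l) →
      S.card ≤ 2 ^ (13 * m) * ((tailSupport u v).card + 2) ^ 2 :=
  permTypeLaw_proof

/-- `PermType` is antitone in the letter family. [folklore] -/
theorem permType_mono {m : ℕ} {A A' : Fin m → Finset Expo} (h : ∀ j, A' j ⊆ A j) (hP : PermType A) : PermType A' := by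
  intro a ha b hb hab
  have hsub : tuples A' ⊆ tuples A := fun c hc =>
    Fintype.mem_piFinset.2 fun j => Finset.insert_subset_insert _ (h j) (Fintype.mem_piFinset.1 hc j)
  exact hP a (hsub ha) b (hsub hb) hab

/-- Merging a singleton block does not enlarge the letter family. [folklore] -/
theorem mergeA_singleton_subset {m : ℕ} (A : Fin m → Finset Expo) (j₀ j : Fin m) : mergeA A {j₀} j₀ j ⊆ A j := by
  classical
  unfold mergeA
  split_ifs with h1 h2
  · subst h1
    intro e he
    obtain ⟨hne, hmem⟩ := Finset.mem_erase.1 he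
    unfold blockSet at hmem
    obtain ⟨a, ha, hsum⟩ := Finset.mem_image.1 hmem
    rw [Finset.sum_singleton] at hsum
    have haj : a j ∈ insert (0 : Expo) (A j) := Fintype.mem_piFinset.1 ha j
    rw [hsum] at haj
    rcases Finset.mem_insert.1 haj with h0 | h
    · exact absurd h0 hne
    · exact h
  · exact absurd (Finset.mem_singleton.1 h2) h1
  · exact fun e he => he

/-- A confined block has a permutation-type merged family. [folklore] -/
theorem permType_mergeA_of_confined {m : ℕ} (A : Fin m → Finset Expo) (J : Finset (Fin m)) (j₀ : Fin m) (hj₀ : j₀ ∈ J)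
    (hconf : Confined A J) : PermType (mergeA A J j₀) :=
  permType_of_injOn _ (injOn_mergeA A J j₀ hj₀ hconf)

/-- `Confined A ∅` (dissociation) gives permutation type. [folklore] -/
theorem permType_of_confined_empty {m : ℕ} (A : Fin m → Finset Expo) (hconf : Confined A ∅) : PermType A := by
  refine permType_of_injOn A fun a ha b hb hab => ?_
  exact funext fun j => hconf a (Finset.mem_coe.1 ha) b (Finset.mem_coe.1 hb) hab j (Finset.notMem_empty j)

/-- **Merged permutation-type law (rung R5 of the line `relation_ladder`, verbatim its `MergedPermTypeLaw`).**  For any block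
`J ∋ j₀` whose sumset has at most `M` points (`BlockSmall`), if the MERGED letter family `mergeA A J j₀` is of permutation type,
then the number of visible exponents of `∏(1+u_j) − ∏(1+v_j)` is at most `2^{13m}(M + m s + 2)^2`.  `J = {j₀}` is
`visibleCount_of_permType`; a confined `J` gives `visibleCount_of_confined_blockSmall` (the regime of `planarCell_blockLaw`,
p608838, globally and with exponent `2`). [folklore] -/
theorem visibleCount_of_mergedPermType {m : ℕ} (s M : ℕ) (u v : Fin m → MvPolynomial (Fin 2) ℂ)
    (A : Fin m → Finset Expo) (J : Finset (Fin m)) (j₀ : Fin m) (hj₀ : j₀ ∈ J) (hA0 : ∀ j, (0 : Expo) ∉ A j)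
    (hAs : ∀ j, (A j).card ≤ s) (hu : ∀ j, (u j).support ⊆ A j) (hv : ∀ j, (v j).support ⊆ A j)
    (hB : BlockSmall A J M) (hperm : PermType (mergeA A J j₀)) (S : Finset Expo)
    (hS : ∀ l ∈ S, ∃ ξ : Fin 2 → ℝ, ValidWeight u v ξ ∧ IsStrictTop ξ ↑(tailDiff u v).support l) :
    S.card ≤ 2 ^ (13 * m) * (M + m * s + 2) ^ 2 := by
  have hu0 : ∀ j, coeff 0 (u j) = 0 := fun j => notMem_support_iff.1 fun h => hA0 j (hu j h)
  have hv0 : ∀ j, coeff 0 (v j) = 0 := fun j => notMem_support_iff.1 fun h => hA0 j (hv j h)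
  have hu0' : ∀ j, coeff 0 (merge u J j₀ j) = 0 := coeff_zero_merge u J j₀ hu0
  have hv0' : ∀ j, coeff 0 (merge v J j₀ j) = 0 := coeff_zero_merge v J j₀ hv0
  have hperm' : PermType (fun j => (merge u J j₀ j).support ∪ (merge v J j₀ j).support) :=
    permType_mono (fun j => Finset.union_subset (support_merge_subset u A J j₀ hj₀ hA0 hu j)
      (support_merge_subset v A J j₀ hj₀ hA0 hv j)) hperm
  have hS' : ∀ l ∈ S, ∃ ξ : Fin 2 → ℝ, ValidWeight (merge u J j₀) (merge v J j₀) ξ ∧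
      IsStrictTop ξ ↑(tailDiff (merge u J j₀) (merge v J j₀)).support l := fun l hl => by
    obtain ⟨ξ, hval, htop⟩ := hS l hl
    exact ⟨ξ, validWeight_merge u v J j₀ hj₀ hu0 hv0 hval, by rw [tailDiff_merge u v J j₀ hj₀]; exact htop⟩
  have key := permTypeLaw_proof m (merge u J j₀) (merge v J j₀) hu0' hv0' hperm' S hS'
  have hT := card_tailSupport_merge_le u v A J j₀ hj₀ hA0 hu hv M s hAs hB
  calc S.card ≤ 2 ^ (13 * m) * ((tailSupport (merge u J j₀) (merge v J j₀)).card + 2) ^ 2 := key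
    _ ≤ 2 ^ (13 * m) * (M + m * s + 2) ^ 2 := Nat.mul_le_mul_left _ (Nat.pow_le_pow_left (by omega) 2)

/-- Confined block with small sumset (the regime of `planarCell_blockLaw`), GLOBAL count with exponent `2`. [folklore] -/
theorem visibleCount_of_confined_blockSmall {m : ℕ} (s M : ℕ) (u v : Fin m → MvPolynomial (Fin 2) ℂ)
    (A : Fin m → Finset Expo) (J : Finset (Fin m)) (j₀ : Fin m) (hj₀ : j₀ ∈ J) (hA0 : ∀ j, (0 : Expo) ∉ A j)
    (hAs : ∀ j, (A j).card ≤ s) (hu : ∀ j, (u j).support ⊆ A j) (hv : ∀ j, (v j).support ⊆ A j)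
    (hconf : Confined A J) (hB : BlockSmall A J M) (S : Finset Expo)
    (hS : ∀ l ∈ S, ∃ ξ : Fin 2 → ℝ, ValidWeight u v ξ ∧ IsStrictTop ξ ↑(tailDiff u v).support l) :
    S.card ≤ 2 ^ (13 * m) * (M + m * s + 2) ^ 2 :=
  visibleCount_of_mergedPermType s M u v A J j₀ hj₀ hA0 hAs hu hv hB (permType_mergeA_of_confined A J j₀ hj₀ hconf) S hS

end Statement

end Summit.ValiantsHypothesis.ValiantsHypothesis.Theorems.NewtonUnitEquations.TwoProducts.PermutationType

end
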